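import Literature.NumberTheory.Sieve.FriedlanderIwaniecPrimesJacobiTwistedSymmetry
import Literature.NumberTheory.LFunctions.PrimeNumberTheoremProgressions
import HarnessLib

/-!
# Friedlander–Iwaniec, *The polynomial `X² + Y⁴` captures its primes*, §13: the algebra of the principle of enlarging moduli ((13.1), (13.3))

[FI, §13 "Jacobi-twisted sums: Enlarging moduli", p. 52 of arXiv:math/9811185]. For the variance
`V(D) = Σ_{D<d≤2D} Σ_{a (mod d)} |Σ_{r̄s ≡ a (mod d)} α_{rs} (r/d')|²` of (11.11) (the tree's
`jtV D (2D) R S α` of `FriedlanderIwaniecPrimesJacobiTwistedForms`) and a prime `p`, the source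
splits the inner sum according to `p ∤ r` / `p ∣ r`:

> "Hence we infer (13.1) `V(D) ≤ 2 Σ_{D<d≤2D} (E_p(d) + E'_p(d))` where
> `E_p(d) = Σ_{a (mod d)} |Σ_{r̄s ≡ a (mod d), p ∤ r} α_{rs} (d/r)|²` and `E'_p(d)` is given by the
> same formula but with the condition `p ∣ r` in place of `p ∤ r`. … In general we have the following
> inequality (monotonicity of the local variance)
> `A(d) = Σ_{a (mod d)} |Σ_{n ≡ a (mod d)} α_n|² = d⁻¹ Σ_{b (mod d)} |Σ_n α_n e(bn/d)|²
> ≤ d⁻¹ Σ_{b (mod dm)} |Σ_n α_n e(bn/dm)|² = m A(dm)`.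
> We apply this with `m = p²` to `E_p(d)` getting (13.3) `E_p(d) ≤ p² E(dp²)` since
> `(dp²/r) = (d/r)` for `p ∤ r`."

This file PROVES these three steps in the tree's vocabulary (no definitions, no named facts):

* `sum_norm_sum_sq_le_mul_sum_range` and **`localVariance_le_mul`** — the monotonicity of the local
  variance `A(d) ≤ m A(dm)`, for any finite set of `n` and any coefficients. (The source proves it
  by Parseval on `ℤ/d`; we take the shorter road: a class modulo `d` is the disjoint union of `m`
  classes modulo `dm`, and Cauchy's inequality `|Σ_{j<m} x_j|² ≤ m Σ_j |x_j|²`.)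
* `jtChar_mul_prime_sq` — `χ_{dp²}(r) = χ_d(r)` for `p ∤ r` (`χ_d(r) = (r/d')`, the tree's `jtChar`;
  for `p = 2` the odd part absorbs `p²`).
* **`jtLocal_notDvd_le_sq_mul`** — (13.3) for one modulus: `E_p(d) ≤ p² E(dp²)`, where
  `E(dp²)` is the `dp²`-term of `V` (the class `a (mod d)` of `r̄s`, `p ∤ r`, refines to the
  `p²` classes `a + dj (mod dp²)`, `j < p²`, the one containing `r̄s` being
  `congrSol (dp²) r s`); summed over `D < d ≤ 2D` and using positivity to pass from the moduli
  `dp²` to all moduli in `(Dp², 2Dp²]`: **`jtV_notDvd_le_sq_mul`**,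
  `V_{p∤r}(D) ≤ p² V(Dp²)` ("we shall ignore the latter property by positivity").
* `jtV_add_le` — (13.1) in the form `V(β + γ) ≤ 2V(β) + 2V(γ)`, and the resulting skeleton of the
  principle, **`jtV_le_enlarged`**: `V(D) ≤ 2p² V(Dp²) + 2 V'_p(D)` with `V'_p` the variance of the
  coefficients `α_{rs} [p ∣ r]` (the term the source then "estimates trivially").

* **`jtV_le_trivial_of_dvd`** — the "trivial" estimate of `Σ_d E'_p(d)`:
  "`Σ_d E'_p(d) ≤ Σ_d Σ_{r₁s₂ ≡ r₂s₁ (mod d)} |α_{pr₁s₁} α_{pr₂s₂}| ≪ {D + p⁻¹(RS)^{1+ε}} Σ_r Σ_s |α_{prs}|²`":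
  for coefficients `β_{rs}` supported on `p ∣ r`, `(r, s) = 1` (the source's standing `(r, 2s) = 1`),
  `V_β(D) ≤ (D + (R/p + 1) S T) ‖β‖²` whenever every non-zero `|n| ≤ 4RS` has at most `T` divisors
  in `(D, 2D]` (Cauchy, at most one class `a` per pair, the diagonal `r₂s₁ = r₁s₂` forces
  `(r₂, s₂) = (r₁, s₁)`, and the multiples of `p` in `(R, 2R]` number `≤ R/p + 1`);
  `jtV_le_trivial_of_dvd_rpow` plugs in the divisor bound `τ(n) ≤ C_ε n^ε` (`DivisorBound`).
* `jtV_weighted_le_enlarged` — (13.2)/(13.4) before the choice of `P`: summing `jtV_le_enlarged`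
  against weights `w_p ≥ 0` over a finite set of primes `Pr`,
  `(Σ_p w_p) V(D) ≤ 2 Σ_p w_p p² V(Dp²) + 2 Σ_p w_p V'_p(D)`.

* `jtV_notDvd_le_sq_mul_sparse`, `sum_primes_sum_Ioc_sq_le`, **`jtV_weighted_le_enlarged_sparse`**
  — the faithful form keeping the moduli `dp²` sparse: for primes `p ∈ (P, 2P]` with `2D < P²` the
  moduli `dp²`, `D < d ≤ 2D`, are pairwise distinct and lie in `(DP², 8DP²]`, so that
  `(Σ_p w_p) V(D) ≤ 2 (max_p w_p p²) V_{(DP², 8DP²]} + 2 Σ_p w_p V'_p(D)` — (13.4) with its factor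
  `P log DP` (for `w_p = p⁻¹ log p`), up to the prime number sum `Σ_{p∼P} p⁻¹ log p ≫ 1`.
* `quarter_le_sum_primes_log_div` — that prime number sum: `Σ_{P<p≤2P} p⁻¹ log p ≥ 1/4` for
  `P ≥ P₀` (from the tree's prime number theorem `θ(X) = X + o(X)`,
  `LFunctions.chebyshevTheta_sub_self_isLittleO`), and the **principle with explicit constants**,
  `jtV_le_enlarged_principle`: for `P ≥ P₀` and `2D < P²`,
  `V(D) ≤ 16 P log(2P) · V_{(DP², 8DP²]}(α) + 8 Σ_{P<p≤2P} p⁻¹ log p · V'_p(D)`.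
* Without the restriction `2D < P²` (the general multiplicity count): a modulus `m ≤ 8DP²` has at
  most `1 + ⌊log_P(8D)/2⌋` representations `m = dp²` with `p ∼ P` prime
  (`card_primes_sq_dvd_le`), so `sum_primes_sum_Ioc_sq_le_mul`, `jtV_weighted_le_enlarged_mul` and
  **`jtV_le_enlarged_principle'`**:
  `V(D) ≤ 16 (1 + ⌊log_P(8D)/2⌋) P log(2P) · V_{(DP², 8DP²]}(α) + 8 Σ_{P<p≤2P} p⁻¹ log p · V'_p(D)`
  for all `P ≥ P₀` and all `D` — the printed factor `P log DP`.
-/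

open Finset
open scoped Nat

namespace Literature.NumberTheory.Sieve.FriedlanderIwaniecPrimes

/-! ### Monotonicity of the local variance -/

/-- Reindexing the classes modulo `dm` as `a + dj`, `a < d`, `j < m`:
`Σ_{b < dm} G(b) = Σ_{a<d} Σ_{j<m} G(a + dj)`. [folklore] -/
private theorem sum_range_mul_eq_sum_sum_range {M : Type*} [AddCommMonoid M] {d : ℕ} (hd : 0 < d) (m : ℕ)
    (G : ℕ → M) : ∑ b ∈ range (d * m), G b = ∑ a ∈ range d, ∑ j ∈ range m, G (a + d * j) := by
  rw [← Finset.sum_product' (s := range d) (t := range m) (f := fun a j => G (a + d * j))]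
  refine Finset.sum_nbij' (fun b => (b % d, b / d)) (fun x => x.1 + d * x.2) ?_ ?_ ?_ ?_ ?_
  · intro b hb
    rw [Finset.mem_range] at hb
    rw [Finset.mem_product, Finset.mem_range, Finset.mem_range]
    exact ⟨Nat.mod_lt _ hd, (Nat.div_lt_iff_lt_mul hd).mpr (by rwa [mul_comm] at hb)⟩
  · rintro ⟨a, j⟩ hx
    rw [Finset.mem_product, Finset.mem_range, Finset.mem_range] at hx
    rw [Finset.mem_range]
    dsimp only at hx ⊢
    calc a + d * j < d + d * j := by omega
      _ = d * (j + 1) := by ring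
      _ ≤ d * m := Nat.mul_le_mul_left _ hx.2
  · intro b _
    exact Nat.mod_add_div b d
  · rintro ⟨a, j⟩ hx
    rw [Finset.mem_product, Finset.mem_range, Finset.mem_range] at hx
    dsimp only at hx ⊢
    simp only [Prod.mk.injEq]
    refine ⟨?_, ?_⟩
    · rw [Nat.add_mul_mod_self_left, Nat.mod_eq_of_lt hx.1]
    · rw [Nat.add_mul_div_left _ _ hd, Nat.div_eq_of_lt hx.1, zero_add]
  · intro b _
    simp only [Nat.mod_add_div]

/-- **Cauchy over a refinement of classes**: `Σ_{a<d} |Σ_{j<m} X(a + dj)|² ≤ m Σ_{b<dm} |X(b)|²`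
(the inequality behind "monotonicity of the local variance").
[cite: FriedlanderIwaniecAnnals1998, §13 display before (13.3)] -/
theorem sum_norm_sum_sq_le_mul_sum_range {d : ℕ} (hd : 0 < d) (m : ℕ) (X : ℕ → ℂ) :
    ∑ a ∈ range d, ‖∑ j ∈ range m, X (a + d * j)‖ ^ 2 ≤
      m * ∑ b ∈ range (d * m), ‖X b‖ ^ 2 := by
  rw [sum_range_mul_eq_sum_sum_range hd m, Finset.mul_sum]
  refine Finset.sum_le_sum fun a _ => ?_
  have h := norm_sum_sq_le_card_mul (range m) (fun j => X (a + d * j))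
  rwa [Finset.card_range] at h

/-- `n mod dm = (n mod d) + d ((n / d) mod m)`. [folklore] -/
private theorem mod_mul_eq_mod_add_mul (n d m : ℕ) : n % (d * m) = n % d + d * (n / d % m) := by
  conv_lhs => rw [← Nat.mod_add_div (n % (d * m)) d]
  rw [Nat.mod_mul_right_mod, Nat.mod_mul_right_div_self]

/-- **Monotonicity of the local variance** [FI, §13, display before (13.3)]: for any finite set
`T` of integers `n ≥ 0`, coefficients `c_n`, and `d, m ≥ 1`,
`A(d) = Σ_{a (mod d)} |Σ_{n ∈ T, n ≡ a (mod d)} c_n|² ≤ m A(dm)`.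
[cite: FriedlanderIwaniecAnnals1998, §13 display before (13.3)] -/
theorem localVariance_le_mul (T : Finset ℕ) (c : ℕ → ℂ) {d m : ℕ} (hd : 0 < d) (hm : 0 < m) :
    ∑ a ∈ range d, ‖∑ n ∈ T with n % d = a, c n‖ ^ 2 ≤
      m * ∑ b ∈ range (d * m), ‖∑ n ∈ T with n % (d * m) = b, c n‖ ^ 2 := by
  have key : ∀ a ∈ range d, ∑ n ∈ T with n % d = a, c n =
      ∑ j ∈ range m, ∑ n ∈ T with n % (d * m) = a + d * j, c n := by
    intro a ha
    rw [Finset.mem_range] at ha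
    rw [← Finset.sum_biUnion]
    · refine Finset.sum_congr ?_ fun _ _ => rfl
      ext n
      simp only [Finset.mem_filter, Finset.mem_biUnion, Finset.mem_range]
      constructor
      · rintro ⟨hn, hmod⟩
        exact ⟨n / d % m, Nat.mod_lt _ hm, hn, by rw [mod_mul_eq_mod_add_mul, hmod]⟩
      · rintro ⟨j, -, hn, hmod⟩
        refine ⟨hn, ?_⟩
        rw [← Nat.mod_mul_right_mod n d m, hmod, Nat.add_mul_mod_self_left, Nat.mod_eq_of_lt ha]
    · intro j₁ _ j₂ _ hne
      simp only [Function.onFun]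
      rw [Finset.disjoint_filter]
      intro n _ h1 h2
      rw [h1] at h2
      exact hne (Nat.eq_of_mul_eq_mul_left hd (Nat.add_left_cancel h2))
  calc ∑ a ∈ range d, ‖∑ n ∈ T with n % d = a, c n‖ ^ 2
      = ∑ a ∈ range d, ‖∑ j ∈ range m, ∑ n ∈ T with n % (d * m) = a + d * j, c n‖ ^ 2 :=
        Finset.sum_congr rfl fun a ha => by rw [key a ha]
    _ ≤ m * ∑ b ∈ range (d * m), ‖∑ n ∈ T with n % (d * m) = b, c n‖ ^ 2 :=
        sum_norm_sum_sq_le_mul_sum_range hd m (fun b => ∑ n ∈ T with n % (d * m) = b, c n)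

/-! ### `χ_{dp²} = χ_d` on `p ∤ r` -/

/-- `(r / (dp²)') = (r / d')` for `p ∤ r` ("since `(dp²/r) = (d/r)` for `p ∤ r`").
[cite: FriedlanderIwaniecAnnals1998, §13 after (13.3)] -/
theorem jtChar_mul_prime_sq {d p r : ℕ} (hd : 0 < d) (hp : p.Prime) (hpr : ¬p ∣ r) :
    jtChar (d * p ^ 2) r = jtChar d r := by
  have hp0 : 0 < p := hp.pos
  rw [← jtChar_mul_jtChar hd (pow_pos hp0 2)]
  suffices h : jtChar (p ^ 2) r = 1 by rw [h, mul_one]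
  rw [jtChar_def, pow_two, ordCompl_two_mul]
  have hc0 : ordCompl[2] p ≠ 0 := (Nat.ordCompl_pos 2 hp0.ne').ne'
  rw [jacobiSym.mul_right' _ hc0 hc0]
  have hcop : r.Coprime p := Nat.coprime_comm.mp ((Nat.Prime.coprime_iff_not_dvd hp).mpr hpr)
  have hg : ((r : ℤ)).gcd ((ordCompl[2] p : ℕ) : ℤ) = 1 := by
    rw [Int.gcd_natCast_natCast]
    exact Nat.Coprime.coprime_dvd_right (Nat.ordCompl_dvd p 2) hcop
  rcases jacobiSym.eq_one_or_neg_one hg with h | h <;> rw [h] <;> norm_num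

/-- `(r, dp²) = 1 ↔ (r, d) = 1 ∧ p ∤ r`. [folklore] -/
private theorem coprime_mul_prime_sq_iff {d p r : ℕ} (hp : p.Prime) :
    r.Coprime (d * p ^ 2) ↔ r.Coprime d ∧ ¬p ∣ r := by
  rw [Nat.coprime_mul_iff_right]
  refine and_congr Iff.rfl ?_
  constructor
  · intro h
    have h1 : r.Coprime p := h.coprime_dvd_right (dvd_pow_self p two_ne_zero)
    exact (Nat.Prime.coprime_iff_not_dvd hp).mp (Nat.coprime_comm.mp h1)
  · intro h
    exact Nat.Coprime.pow_right 2 (Nat.coprime_comm.mp ((Nat.Prime.coprime_iff_not_dvd hp).mpr h))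

/-! ### (13.3) -/

/-- **(13.3) for one modulus: `E_p(d) ≤ p² E(dp²)`.** For `d ≥ 1`, a prime `p`, and any
coefficients on the box `R < r ≤ 2R`, `S < s ≤ 2S`:
`Σ_{a (mod d)} |Σ_{r̄s ≡ a (d), p ∤ r} α_{rs} χ_d(r)|² ≤ p² Σ_{a (mod dp²)} |Σ_{r̄s ≡ a (dp²)} α_{rs} χ_{dp²}(r)|²`
(the condition `(r, dp²) = 1` implicit in `r̄s (mod dp²)` forces `p ∤ r`).
[cite: FriedlanderIwaniecAnnals1998, (13.3)] -/
theorem jtLocal_notDvd_le_sq_mul {d p : ℕ} (hd : 0 < d) (hp : p.Prime) (R S : ℕ) (α : ℕ → ℕ → ℂ) :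
    ∑ a ∈ range d, ‖∑ r ∈ Ioc R (2 * R), ∑ s ∈ Ioc S (2 * S),
        (if r.Coprime d ∧ ¬p ∣ r ∧ (d : ℤ) ∣ (s : ℤ) - (a : ℤ) * r
          then α r s * (jtChar d r : ℂ) else 0)‖ ^ 2 ≤
      (p : ℝ) ^ 2 * ∑ a ∈ range (d * p ^ 2), ‖∑ r ∈ Ioc R (2 * R), ∑ s ∈ Ioc S (2 * S),
        (if r.Coprime (d * p ^ 2) ∧ ((d * p ^ 2 : ℕ) : ℤ) ∣ (s : ℤ) - (a : ℤ) * r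
          then α r s * (jtChar (d * p ^ 2) r : ℂ) else 0)‖ ^ 2 := by
  have hp0 : 0 < p := hp.pos
  have hp2 : 0 < p ^ 2 := pow_pos hp0 2
  set q : ℕ := d * p ^ 2 with hq
  have hq0 : 0 < q := Nat.mul_pos hd hp2
  have hdq : (d : ℤ) ∣ (q : ℤ) := by rw [hq]; push_cast; exact dvd_mul_right _ _
  set X : ℕ → ℂ := fun b => ∑ r ∈ Ioc R (2 * R), ∑ s ∈ Ioc S (2 * S),
      (if r.Coprime q ∧ (q : ℤ) ∣ (s : ℤ) - (b : ℤ) * r then α r s * (jtChar q r : ℂ) else 0)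
    with hX
  -- each class `a (mod d)` of `r̄ s` (`p ∤ r`) is the union of the classes `a + dj (mod q)`, `j < p²`
  have key : ∀ a ∈ range d, (∑ r ∈ Ioc R (2 * R), ∑ s ∈ Ioc S (2 * S),
      (if r.Coprime d ∧ ¬p ∣ r ∧ (d : ℤ) ∣ (s : ℤ) - (a : ℤ) * r
        then α r s * (jtChar d r : ℂ) else 0)) = ∑ j ∈ range (p ^ 2), X (a + d * j) := by
    intro a ha
    rw [Finset.mem_range] at ha
    simp only [hX]
    conv_rhs => rw [Finset.sum_comm]
    refine Finset.sum_congr rfl fun r _ => ?_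
    conv_rhs => rw [Finset.sum_comm]
    refine Finset.sum_congr rfl fun s _ => ?_
    by_cases hcop : r.Coprime q
    · obtain ⟨hcd, hpr⟩ := (coprime_mul_prime_sq_iff hp).mp hcop
      have hχ : (jtChar q r : ℂ) = (jtChar d r : ℂ) := by rw [hq, jtChar_mul_prime_sq hd hp hpr]
      by_cases hX : (d : ℤ) ∣ (s : ℤ) - (a : ℤ) * r
      · rw [if_pos ⟨hcd, hpr, hX⟩]
        -- the unique `j`
        set b₀ := congrSol q r s with hb₀
        have hab₀ : b₀ % d = a := by
          rw [hb₀, congrSol_mod hq0 hd (Int.natCast_dvd_natCast.mp hdq) hcop s]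
          exact ((dvd_sub_mul_iff_eq_congrSol hd hcd s ha).mp hX).symm
        have hb₀eq : a + d * (b₀ / d) = b₀ := by
          have := Nat.mod_add_div b₀ d
          rwa [hab₀] at this
        have hj₀ : b₀ / d < p ^ 2 := by
          rw [Nat.div_lt_iff_lt_mul hd, mul_comm]
          exact congrSol_lt hq0 r s
        symm
        calc ∑ j ∈ range (p ^ 2), (if r.Coprime q ∧ (q : ℤ) ∣ (s : ℤ) - ((a + d * j : ℕ) : ℤ) * r
              then α r s * (jtChar q r : ℂ) else 0)
            = ∑ j ∈ range (p ^ 2), (if j = b₀ / d then α r s * (jtChar d r : ℂ) else 0) := by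
              refine Finset.sum_congr rfl fun j hj => ?_
              rw [Finset.mem_range] at hj
              rw [hχ]
              by_cases hjj : j = b₀ / d
              · have hdvd : (q : ℤ) ∣ (s : ℤ) - ((a + d * j : ℕ) : ℤ) * r := by
                  have h0 := dvd_sub_congrSol_mul hq0 hcop s
                  rwa [← hb₀, ← hb₀eq, ← hjj] at h0
                rw [if_pos hjj, if_pos ⟨hcop, hdvd⟩]
              · rw [if_neg hjj, if_neg ?_]
                rintro ⟨-, hdiv⟩
                apply hjj
                have hlt : a + d * j < q := by
                  calc a + d * j < d + d * j := by omega
                    _ = d * (j + 1) := by ring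
                    _ ≤ d * p ^ 2 := Nat.mul_le_mul_left _ hj
                have h1 := (dvd_sub_mul_iff_eq_congrSol hq0 hcop s hlt).mp hdiv
                have h2 : d * j = d * (b₀ / d) := by omega
                exact Nat.eq_of_mul_eq_mul_left hd h2
          _ = α r s * (jtChar d r : ℂ) := by
              rw [Finset.sum_ite_eq', if_pos (Finset.mem_range.mpr hj₀)]
      · rw [if_neg fun h => hX h.2.2]
        symm
        refine Finset.sum_eq_zero fun j _ => if_neg ?_
        rintro ⟨-, hdiv⟩
        apply hX
        have h1 := hdq.trans hdiv
        have e : (s : ℤ) - (a : ℤ) * r =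
            ((s : ℤ) - ((a + d * j : ℕ) : ℤ) * r) + (d : ℤ) * ((j : ℤ) * r) := by
          push_cast; ring
        rw [e]
        exact dvd_add h1 (dvd_mul_right _ _)
    · have hnot : ¬(r.Coprime d ∧ ¬p ∣ r ∧ (d : ℤ) ∣ (s : ℤ) - (a : ℤ) * r) := fun h =>
        hcop ((coprime_mul_prime_sq_iff hp).mpr ⟨h.1, h.2.1⟩)
      rw [if_neg hnot]
      symm
      exact Finset.sum_eq_zero fun j _ => if_neg fun h => hcop h.1
  calc ∑ a ∈ range d, ‖∑ r ∈ Ioc R (2 * R), ∑ s ∈ Ioc S (2 * S),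
        (if r.Coprime d ∧ ¬p ∣ r ∧ (d : ℤ) ∣ (s : ℤ) - (a : ℤ) * r
          then α r s * (jtChar d r : ℂ) else 0)‖ ^ 2
      = ∑ a ∈ range d, ‖∑ j ∈ range (p ^ 2), X (a + d * j)‖ ^ 2 :=
        Finset.sum_congr rfl fun a ha => by rw [key a ha]
    _ ≤ (p ^ 2 : ℕ) * ∑ b ∈ range (d * p ^ 2), ‖X b‖ ^ 2 := sum_norm_sum_sq_le_mul_sum_range hd _ X
    _ = (p : ℝ) ^ 2 * ∑ b ∈ range q, ‖X b‖ ^ 2 := by rw [Nat.cast_pow]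

/-! ### (13.1) and (13.3) for the variance `V(D)` -/

/-- `‖x + y‖² ≤ 2‖x‖² + 2‖y‖²`. [folklore] -/
private theorem norm_add_sq_le_two_mul_add (x y : ℂ) : ‖x + y‖ ^ 2 ≤ 2 * ‖x‖ ^ 2 + 2 * ‖y‖ ^ 2 := by
  have h1 : ‖x + y‖ ^ 2 ≤ (‖x‖ + ‖y‖) ^ 2 := pow_le_pow_left₀ (norm_nonneg _) (norm_add_le x y) 2
  nlinarith [sq_nonneg (‖x‖ - ‖y‖)]

/-- **(13.1), abstract form**: `V(β + γ) ≤ 2V(β) + 2V(γ)` (the source splits `α = α[p∤r] + α[p∣r]`).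
[cite: FriedlanderIwaniecAnnals1998, (13.1)] -/
theorem jtV_add_le (D₁ D₂ R S : ℕ) (β γ : ℕ → ℕ → ℂ) :
    jtV D₁ D₂ R S (β + γ) ≤ 2 * jtV D₁ D₂ R S β + 2 * jtV D₁ D₂ R S γ := by
  simp only [jtV_def, Finset.mul_sum, ← Finset.sum_add_distrib]
  refine Finset.sum_le_sum fun d _ => Finset.sum_le_sum fun a _ => ?_
  have hsplit : (∑ r ∈ Ioc R (2 * R), ∑ s ∈ Ioc S (2 * S),
      (if r.Coprime d ∧ (d : ℤ) ∣ (s : ℤ) - (a : ℤ) * r then (β + γ) r s * (jtChar d r : ℂ) else 0)) =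
      (∑ r ∈ Ioc R (2 * R), ∑ s ∈ Ioc S (2 * S),
        (if r.Coprime d ∧ (d : ℤ) ∣ (s : ℤ) - (a : ℤ) * r then β r s * (jtChar d r : ℂ) else 0)) +
      ∑ r ∈ Ioc R (2 * R), ∑ s ∈ Ioc S (2 * S),
        (if r.Coprime d ∧ (d : ℤ) ∣ (s : ℤ) - (a : ℤ) * r then γ r s * (jtChar d r : ℂ) else 0) := by
    rw [← Finset.sum_add_distrib]
    refine Finset.sum_congr rfl fun r _ => ?_
    rw [← Finset.sum_add_distrib]
    refine Finset.sum_congr rfl fun s _ => ?_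
    split_ifs
    · simp only [Pi.add_apply]; ring
    · simp
  rw [hsplit]
  exact norm_add_sq_le_two_mul_add _ _

/-- **(13.3) for the variance: `V_{p∤r}(D) ≤ p² V(Dp²)`.** The variance of the coefficients
`α_{rs} [p ∤ r]` over the moduli `D < d ≤ 2D` is at most `p²` times the variance of `α_{rs}`
over the moduli `Dp² < d' ≤ 2Dp²` — (13.3) summed over `d`, keeping only the moduli `d' = dp²`
by positivity. [cite: FriedlanderIwaniecAnnals1998, (13.3)] -/
theorem jtV_notDvd_le_sq_mul (D R S : ℕ) {p : ℕ} (hp : p.Prime) (α : ℕ → ℕ → ℂ) :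
    jtV D (2 * D) R S (fun r s => if p ∣ r then 0 else α r s) ≤
      (p : ℝ) ^ 2 * jtV (D * p ^ 2) (2 * (D * p ^ 2)) R S α := by
  have hp2 : 0 < p ^ 2 := pow_pos hp.pos 2
  rw [jtV_def, jtV_def]
  set F : ℕ → ℝ := fun x => ∑ a ∈ range x, ‖∑ r ∈ Ioc R (2 * R), ∑ s ∈ Ioc S (2 * S),
      (if r.Coprime x ∧ (x : ℤ) ∣ (s : ℤ) - (a : ℤ) * r then α r s * (jtChar x r : ℂ) else 0)‖ ^ 2
    with hF
  have hF0 : ∀ x, 0 ≤ F x := fun x => by simp only [hF]; positivity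
  -- (13.3) termwise
  have h1 : ∀ d ∈ Ioc D (2 * D), (∑ a ∈ range d, ‖∑ r ∈ Ioc R (2 * R), ∑ s ∈ Ioc S (2 * S),
      (if r.Coprime d ∧ (d : ℤ) ∣ (s : ℤ) - (a : ℤ) * r then
        (fun r s => if p ∣ r then 0 else α r s) r s * (jtChar d r : ℂ) else 0)‖ ^ 2) ≤
      (p : ℝ) ^ 2 * F (d * p ^ 2) := by
    intro d hd
    have hd0 : 0 < d := lt_of_le_of_lt (Nat.zero_le D) (Finset.mem_Ioc.mp hd).1
    refine le_trans (le_of_eq ?_) (jtLocal_notDvd_le_sq_mul hd0 hp R S α)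
    refine Finset.sum_congr rfl fun a _ => ?_
    congr 2
    refine Finset.sum_congr rfl fun r _ => Finset.sum_congr rfl fun s _ => ?_
    by_cases hpr : p ∣ r
    · simp [hpr]
    · simp [hpr]
  -- positivity: the moduli `dp²`, `D < d ≤ 2D`, lie in `(Dp², 2Dp²]`
  have h2 : ∑ d ∈ Ioc D (2 * D), F (d * p ^ 2) ≤ ∑ x ∈ Ioc (D * p ^ 2) (2 * (D * p ^ 2)), F x := by
    rw [← Finset.sum_image (s := Ioc D (2 * D)) (g := fun d => d * p ^ 2)
      (fun x _ y _ h => Nat.eq_of_mul_eq_mul_right hp2 h)]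
    refine Finset.sum_le_sum_of_subset_of_nonneg (fun x hx => ?_) fun x _ _ => hF0 x
    rw [Finset.mem_image] at hx
    obtain ⟨d, hd, rfl⟩ := hx
    rw [Finset.mem_Ioc] at hd ⊢
    constructor
    · exact Nat.mul_lt_mul_of_pos_right hd.1 hp2
    · calc d * p ^ 2 ≤ 2 * D * p ^ 2 := Nat.mul_le_mul_right _ hd.2
        _ = 2 * (D * p ^ 2) := by ring
  calc ∑ d ∈ Ioc D (2 * D), ∑ a ∈ range d, ‖∑ r ∈ Ioc R (2 * R), ∑ s ∈ Ioc S (2 * S),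
        (if r.Coprime d ∧ (d : ℤ) ∣ (s : ℤ) - (a : ℤ) * r then
          (fun r s => if p ∣ r then 0 else α r s) r s * (jtChar d r : ℂ) else 0)‖ ^ 2
      ≤ ∑ d ∈ Ioc D (2 * D), (p : ℝ) ^ 2 * F (d * p ^ 2) := Finset.sum_le_sum h1
    _ = (p : ℝ) ^ 2 * ∑ d ∈ Ioc D (2 * D), F (d * p ^ 2) := by rw [← Finset.mul_sum]
    _ ≤ (p : ℝ) ^ 2 * ∑ x ∈ Ioc (D * p ^ 2) (2 * (D * p ^ 2)), F x :=
        mul_le_mul_of_nonneg_left h2 (by positivity)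

/-- **The algebraic skeleton of the principle of enlarging moduli** ((13.1) with (13.3)): for every
prime `p`, `V(D) ≤ 2p² V(Dp²) + 2 V'_p(D)`, where `V(Dp²)` is the variance of `α` over the
moduli `(Dp², 2Dp²]` and `V'_p(D)` that of `α_{rs}[p ∣ r]` over `(D, 2D]`.
[cite: FriedlanderIwaniecAnnals1998, (13.1)-(13.3)] -/
theorem jtV_le_enlarged (D R S : ℕ) {p : ℕ} (hp : p.Prime) (α : ℕ → ℕ → ℂ) :
    jtV D (2 * D) R S α ≤ 2 * (p : ℝ) ^ 2 * jtV (D * p ^ 2) (2 * (D * p ^ 2)) R S α +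
      2 * jtV D (2 * D) R S (fun r s => if p ∣ r then α r s else 0) := by
  have hsplit : α = (fun r s => if p ∣ r then 0 else α r s) + fun r s => if p ∣ r then α r s else 0 := by
    funext r s
    simp only [Pi.add_apply]
    split_ifs <;> simp
  have h1 := jtV_add_le D (2 * D) R S (fun r s => if p ∣ r then 0 else α r s)
    (fun r s => if p ∣ r then α r s else 0)
  rw [← hsplit] at h1
  have h2 := jtV_notDvd_le_sq_mul D R S hp α
  linarith

/-! ### The trivial estimate for `Σ_d E'_p(d)` -/

section Trivial

/-- At most one class `a (mod d)` carries a given pair `x = (r₁, s₁)`, and if it also carries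
`y = (r₂, s₂)` then `d ∣ r₂s₁ - r₁s₂`:
`Σ_{a<d} [x, y ∈ class a] V ≤ [d ∣ r₂s₁ - r₁s₂] V` (`V ≥ 0`). [folklore] -/
private theorem sum_range_ite_and_le {d : ℕ} (hd : 0 < d) (x y : ℕ × ℕ) {V : ℝ} (hV : 0 ≤ V) :
    ∑ a ∈ range d, (if (x.1.Coprime d ∧ (d : ℤ) ∣ (x.2 : ℤ) - (a : ℤ) * x.1) ∧
        (y.1.Coprime d ∧ (d : ℤ) ∣ (y.2 : ℤ) - (a : ℤ) * y.1) then V else 0) ≤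
      if (d : ℤ) ∣ (y.1 : ℤ) * x.2 - (x.1 : ℤ) * y.2 then V else 0 := by
  have hR0 : 0 ≤ (if (d : ℤ) ∣ (y.1 : ℤ) * x.2 - (x.1 : ℤ) * y.2 then V else 0) := by
    split_ifs
    · exact hV
    · exact le_rfl
  by_cases hx : x.1.Coprime d
  · calc ∑ a ∈ range d, (if (x.1.Coprime d ∧ (d : ℤ) ∣ (x.2 : ℤ) - (a : ℤ) * x.1) ∧
          (y.1.Coprime d ∧ (d : ℤ) ∣ (y.2 : ℤ) - (a : ℤ) * y.1) then V else 0)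
        ≤ ∑ a ∈ range d, (if (d : ℤ) ∣ (x.2 : ℤ) - (a : ℤ) * x.1 then
            (if (d : ℤ) ∣ (y.1 : ℤ) * x.2 - (x.1 : ℤ) * y.2 then V else 0) else 0) := by
          refine Finset.sum_le_sum fun a _ => ?_
          by_cases hAB : (x.1.Coprime d ∧ (d : ℤ) ∣ (x.2 : ℤ) - (a : ℤ) * x.1) ∧
              (y.1.Coprime d ∧ (d : ℤ) ∣ (y.2 : ℤ) - (a : ℤ) * y.1)
          · have hC : (d : ℤ) ∣ (y.1 : ℤ) * x.2 - (x.1 : ℤ) * y.2 := by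
              have e : (y.1 : ℤ) * x.2 - (x.1 : ℤ) * y.2 =
                  (y.1 : ℤ) * ((x.2 : ℤ) - (a : ℤ) * x.1) - (x.1 : ℤ) * ((y.2 : ℤ) - (a : ℤ) * y.1) := by
                ring
              rw [e]
              exact dvd_sub (hAB.1.2.mul_left _) (hAB.2.2.mul_left _)
            rw [if_pos hAB, if_pos hAB.1.2, if_pos hC]
          · rw [if_neg hAB]
            split_ifs
            · exact hV
            · exact le_rfl
            · exact le_rfl
      _ = if (d : ℤ) ∣ (y.1 : ℤ) * x.2 - (x.1 : ℤ) * y.2 then V else 0 :=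
          sum_range_ite_dvd_sub_mul hd hx x.2 fun _ =>
            (if (d : ℤ) ∣ (y.1 : ℤ) * x.2 - (x.1 : ℤ) * y.2 then V else 0)
  · rw [Finset.sum_eq_zero fun a _ => if_neg fun h => hx h.1.1]
    exact hR0

/-- Two coprime pairs in the box with `r₂s₁ = r₁s₂` coincide. [folklore] -/
private theorem eq_of_coprime_of_mul_eq {x y : ℕ × ℕ} (hx0 : 0 < x.1) (hxc : x.1.Coprime x.2)
    (hyc : y.1.Coprime y.2) (h : y.1 * x.2 = x.1 * y.2) : y = x := by
  have h1 : x.1 ∣ y.1 := hxc.dvd_of_dvd_mul_right (Dvd.intro _ h.symm)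
  have h2 : y.1 ∣ x.1 := hyc.dvd_of_dvd_mul_right (Dvd.intro _ h)
  have h3 : y.1 = x.1 := Nat.dvd_antisymm h2 h1
  refine Prod.ext h3 ?_
  rw [h3] at h
  exact (Nat.eq_of_mul_eq_mul_left hx0 h).symm

/-- The multiples of `p` in `(R, 2R]` number at most `R/p + 1`. [folklore] -/
private theorem card_Ioc_filter_dvd_le (R : ℕ) {p : ℕ} (hp : 0 < p) :
    #((Ioc R (2 * R)).filter fun r => p ∣ r) ≤ R / p + 1 := by
  have h2R : 2 * R / p ≤ 2 * (R / p) + 1 := by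
    have h1 : R < R / p * p + p := Nat.lt_div_mul_add hp
    have h2 : 2 * R / p < 2 * (R / p) + 2 := by
      rw [Nat.div_lt_iff_lt_mul hp]
      nlinarith
    omega
  calc #((Ioc R (2 * R)).filter fun r => p ∣ r) ≤ #(Ioc (R / p) (2 * R / p)) := by
        refine Finset.card_le_card_of_injOn (fun r => r / p) (fun r hr => ?_) (fun r hr r' hr' h => ?_)
        · rw [Finset.mem_coe, Finset.mem_filter, Finset.mem_Ioc] at hr
          obtain ⟨⟨hr1, hr2⟩, k, rfl⟩ := hr
          dsimp only
          rw [Finset.mem_coe, Finset.mem_Ioc, Nat.mul_div_cancel_left _ hp]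
          refine ⟨(Nat.div_lt_iff_lt_mul hp).mpr (by rwa [mul_comm] at hr1), ?_⟩
          exact (Nat.le_div_iff_mul_le hp).mpr (by rwa [mul_comm] at hr2)
        · rw [Finset.mem_coe, Finset.mem_filter] at hr hr'
          obtain ⟨k, hk⟩ := hr.2
          obtain ⟨k', hk'⟩ := hr'.2
          dsimp only at h
          rw [hk, hk', Nat.mul_div_cancel_left _ hp, Nat.mul_div_cancel_left _ hp] at h
          rw [hk, hk', h]
    _ = 2 * R / p - R / p := Nat.card_Ioc _ _
    _ ≤ R / p + 1 := by omega

/-- **The trivial estimate** [FI, §13 after (13.1)]: for coefficients `β_{rs}` supported on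
`p ∣ r`, `(r, s) = 1` (`R < r ≤ 2R`, `S < s ≤ 2S`), if every non-zero integer `|n| ≤ 4RS` has at
most `T` divisors in `(D, 2D]`, then
`V_β(D) ≤ (D + (R/p + 1) S T) Σ_r Σ_s |β_{rs}|²` — the printed
"`Σ_d E'_p(d) ≤ Σ_d Σ_{r₁s₂ ≡ r₂s₁ (mod d)} |α_{pr₁s₁}α_{pr₂s₂}| ≪ {D + p⁻¹(RS)^{1+ε}} Σ_r Σ_s |α_{prs}|²`"
with the divisor bound kept as the parameter `T`. [cite: FriedlanderIwaniecAnnals1998, §13 after (13.1)] -/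
theorem jtV_le_trivial_of_dvd (D R S : ℕ) {p : ℕ} (hp : p.Prime) (β : ℕ → ℕ → ℂ)
    (hβp : ∀ r s, β r s ≠ 0 → p ∣ r) (hβc : ∀ r s, β r s ≠ 0 → r.Coprime s) {T : ℝ} (hT0 : 0 ≤ T)
    (hT : ∀ n : ℤ, n ≠ 0 → |n| ≤ 4 * R * S → (#((Ioc D (2 * D)).filter fun d : ℕ => (d : ℤ) ∣ n) : ℝ) ≤ T) :
    jtV D (2 * D) R S β ≤ ((D : ℝ) + ((R : ℝ) / p + 1) * S * T) *
      ∑ r ∈ Ioc R (2 * R), ∑ s ∈ Ioc S (2 * S), ‖β r s‖ ^ 2 := by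
  rw [jtV_def]
  set 𝒟 := Ioc D (2 * D) with h𝒟
  set B := Ioc R (2 * R) ×ˢ Ioc S (2 * S) with hB
  set K : ℝ := (D : ℝ) + ((R : ℝ) / p + 1) * S * T with hK
  have hK0 : 0 ≤ K := by positivity
  -- the divisor count `N(x, y) = #{d ∈ 𝒟 : d ∣ r₂s₁ - r₁s₂}`
  set N : ℕ × ℕ → ℕ × ℕ → ℕ := fun x y =>
    #(𝒟.filter fun d : ℕ => (d : ℤ) ∣ (y.1 : ℤ) * x.2 - (x.1 : ℤ) * y.2) with hN
  have hNsymm : ∀ x y, N x y = N y x := by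
    intro x y
    simp only [hN]
    congr 1
    ext d
    simp only [Finset.mem_filter]
    refine and_congr Iff.rfl ⟨fun h => ?_, fun h => ?_⟩
    · have := h.neg_right; rwa [neg_sub] at this
    · have := h.neg_right; rwa [neg_sub] at this
  -- Steps 1–2: Cauchy and at most one class per pair
  have h12 : ∀ d ∈ 𝒟, ∑ a ∈ range d, ‖∑ r ∈ Ioc R (2 * R), ∑ s ∈ Ioc S (2 * S),
      (if r.Coprime d ∧ (d : ℤ) ∣ (s : ℤ) - (a : ℤ) * r then β r s * (jtChar d r : ℂ) else 0)‖ ^ 2 ≤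
      ∑ x ∈ B, ∑ y ∈ B, (if (d : ℤ) ∣ (y.1 : ℤ) * x.2 - (x.1 : ℤ) * y.2
        then ‖β x.1 x.2‖ * ‖β y.1 y.2‖ else 0) := by
    intro d hd
    have hd0 : 0 < d := lt_of_le_of_lt (Nat.zero_le D) (Finset.mem_Ioc.mp hd).1
    have hinner : ∀ a : ℕ, (∑ r ∈ Ioc R (2 * R), ∑ s ∈ Ioc S (2 * S),
        (if r.Coprime d ∧ (d : ℤ) ∣ (s : ℤ) - (a : ℤ) * r then β r s * (jtChar d r : ℂ) else 0)) =
        ∑ x ∈ B, (if x.1.Coprime d ∧ (d : ℤ) ∣ (x.2 : ℤ) - (a : ℤ) * x.1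
          then β x.1 x.2 * (jtChar d x.1 : ℂ) else 0) := by
      intro a
      rw [hB, Finset.sum_product]
    calc ∑ a ∈ range d, ‖∑ r ∈ Ioc R (2 * R), ∑ s ∈ Ioc S (2 * S),
          (if r.Coprime d ∧ (d : ℤ) ∣ (s : ℤ) - (a : ℤ) * r then β r s * (jtChar d r : ℂ) else 0)‖ ^ 2
        = ∑ a ∈ range d, ‖∑ x ∈ B, (if x.1.Coprime d ∧ (d : ℤ) ∣ (x.2 : ℤ) - (a : ℤ) * x.1
            then β x.1 x.2 * (jtChar d x.1 : ℂ) else 0)‖ ^ 2 :=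
          Finset.sum_congr rfl fun a _ => by rw [hinner a]
      _ ≤ ∑ a ∈ range d, (∑ x ∈ B, (if x.1.Coprime d ∧ (d : ℤ) ∣ (x.2 : ℤ) - (a : ℤ) * x.1
            then ‖β x.1 x.2‖ else 0)) ^ 2 := by
          refine Finset.sum_le_sum fun a _ => ?_
          refine pow_le_pow_left₀ (norm_nonneg _)
            ((norm_sum_le _ _).trans (Finset.sum_le_sum fun x _ => ?_)) 2
          split_ifs with h
          · rw [norm_mul]
            calc ‖β x.1 x.2‖ * ‖(jtChar d x.1 : ℂ)‖ ≤ ‖β x.1 x.2‖ * 1 :=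
                  mul_le_mul_of_nonneg_left (norm_jtChar_le_one _ _) (norm_nonneg _)
              _ = ‖β x.1 x.2‖ := mul_one _
          · rw [norm_zero]
      _ = ∑ a ∈ range d, ∑ x ∈ B, ∑ y ∈ B,
            (if x.1.Coprime d ∧ (d : ℤ) ∣ (x.2 : ℤ) - (a : ℤ) * x.1 then ‖β x.1 x.2‖ else 0) *
            (if y.1.Coprime d ∧ (d : ℤ) ∣ (y.2 : ℤ) - (a : ℤ) * y.1 then ‖β y.1 y.2‖ else 0) := by
          refine Finset.sum_congr rfl fun a _ => ?_
          rw [sq, Finset.sum_mul_sum]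
      _ = ∑ x ∈ B, ∑ y ∈ B, ∑ a ∈ range d,
            (if (x.1.Coprime d ∧ (d : ℤ) ∣ (x.2 : ℤ) - (a : ℤ) * x.1) ∧
              (y.1.Coprime d ∧ (d : ℤ) ∣ (y.2 : ℤ) - (a : ℤ) * y.1)
              then ‖β x.1 x.2‖ * ‖β y.1 y.2‖ else 0) := by
          rw [Finset.sum_comm]
          refine Finset.sum_congr rfl fun x _ => ?_
          rw [Finset.sum_comm]
          refine Finset.sum_congr rfl fun y _ => Finset.sum_congr rfl fun a _ => ?_
          by_cases hP : x.1.Coprime d ∧ (d : ℤ) ∣ (x.2 : ℤ) - (a : ℤ) * x.1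
          · by_cases hQ : y.1.Coprime d ∧ (d : ℤ) ∣ (y.2 : ℤ) - (a : ℤ) * y.1
            · rw [if_pos hP, if_pos hQ, if_pos ⟨hP, hQ⟩]
            · rw [if_pos hP, if_neg hQ, if_neg fun h => hQ h.2, mul_zero]
          · rw [if_neg hP, zero_mul, if_neg fun h => hP h.1]
      _ ≤ ∑ x ∈ B, ∑ y ∈ B, (if (d : ℤ) ∣ (y.1 : ℤ) * x.2 - (x.1 : ℤ) * y.2
            then ‖β x.1 x.2‖ * ‖β y.1 y.2‖ else 0) :=
          Finset.sum_le_sum fun x _ => Finset.sum_le_sum fun y _ =>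
            sum_range_ite_and_le hd0 x y (by positivity)
  -- Step 3: summing over `d` produces the divisor counts `N(x, y)`
  have h3 : ∑ d ∈ 𝒟, ∑ x ∈ B, ∑ y ∈ B, (if (d : ℤ) ∣ (y.1 : ℤ) * x.2 - (x.1 : ℤ) * y.2
        then ‖β x.1 x.2‖ * ‖β y.1 y.2‖ else 0) =
      ∑ x ∈ B, ∑ y ∈ B, ‖β x.1 x.2‖ * ‖β y.1 y.2‖ * (N x y : ℝ) := by
    rw [Finset.sum_comm]
    refine Finset.sum_congr rfl fun x _ => ?_
    rw [Finset.sum_comm]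
    refine Finset.sum_congr rfl fun y _ => ?_
    simp only [hN]
    rw [← Finset.sum_filter, Finset.sum_const, nsmul_eq_mul, mul_comm]
  -- Step 4: `|β_x||β_y| ≤ (|β_x|² + |β_y|²)/2` and the symmetry of `N`
  set A : ℕ × ℕ → ℕ × ℕ → ℝ := fun x y =>
    ‖β x.1 x.2‖ ^ 2 * (if β y.1 y.2 ≠ 0 then (N x y : ℝ) else 0) with hA
  have h4 : ∑ x ∈ B, ∑ y ∈ B, ‖β x.1 x.2‖ * ‖β y.1 y.2‖ * (N x y : ℝ) ≤ ∑ x ∈ B, ∑ y ∈ B, A x y := by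
    have hpt : ∀ x y, ‖β x.1 x.2‖ * ‖β y.1 y.2‖ * (N x y : ℝ) ≤ (A x y + A y x) / 2 := by
      intro x y
      simp only [hA]
      by_cases hx : β x.1 x.2 = 0
      · rw [hx, norm_zero]
        simp only [ne_eq, not_true_eq_false, if_false]
        have : 0 ≤ ‖β y.1 y.2‖ ^ 2 * (if ¬β y.1 y.2 = 0 then (N y x : ℝ) else 0) := by
          split_ifs <;> positivity
        linarith
      by_cases hy : β y.1 y.2 = 0
      · rw [hy, norm_zero]
        simp only [ne_eq, not_true_eq_false, if_false]
        have : 0 ≤ ‖β x.1 x.2‖ ^ 2 * (if ¬β x.1 x.2 = 0 then (N x y : ℝ) else 0) := by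
          rw [if_pos hx]; positivity
        linarith
      rw [if_pos hy, if_pos hx, hNsymm y x]
      nlinarith [sq_nonneg (‖β x.1 x.2‖ - ‖β y.1 y.2‖), Nat.cast_nonneg (α := ℝ) (N x y),
        mul_nonneg (sq_nonneg (‖β x.1 x.2‖ - ‖β y.1 y.2‖)) (Nat.cast_nonneg (α := ℝ) (N x y))]
    have hcomm : ∑ x ∈ B, ∑ y ∈ B, A y x = ∑ x ∈ B, ∑ y ∈ B, A x y := Finset.sum_comm
    calc ∑ x ∈ B, ∑ y ∈ B, ‖β x.1 x.2‖ * ‖β y.1 y.2‖ * (N x y : ℝ)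
        ≤ ∑ x ∈ B, ∑ y ∈ B, (A x y + A y x) / 2 :=
          Finset.sum_le_sum fun x _ => Finset.sum_le_sum fun y _ => hpt x y
      _ = (∑ x ∈ B, ∑ y ∈ B, A x y + ∑ x ∈ B, ∑ y ∈ B, A y x) / 2 := by
          rw [← Finset.sum_add_distrib, Finset.sum_div]
          refine Finset.sum_congr rfl fun x _ => ?_
          rw [← Finset.sum_add_distrib, Finset.sum_div]
      _ = ∑ x ∈ B, ∑ y ∈ B, A x y := by rw [hcomm]; ring
  -- Step 5: the count for a fixed pair `x` in the support
  have h5 : ∀ x ∈ B, β x.1 x.2 ≠ 0 →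
      ∑ y ∈ B, (if β y.1 y.2 ≠ 0 then (N x y : ℝ) else 0) ≤ K := by
    intro x hx hβx
    have hxB := hx
    rw [hB, Finset.mem_product, Finset.mem_Ioc, Finset.mem_Ioc] at hxB
    have hx0 : 0 < x.1 := lt_of_le_of_lt (Nat.zero_le R) hxB.1.1
    rw [← Finset.add_sum_erase B _ hx, if_pos hβx]
    -- the diagonal term: `N(x, x) = #𝒟 = D`
    have hNxx : (N x x : ℝ) ≤ D := by
      simp only [hN]
      calc (#(𝒟.filter fun d : ℕ => (d : ℤ) ∣ (x.1 : ℤ) * x.2 - (x.1 : ℤ) * x.2) : ℝ) ≤ #𝒟 := by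
            exact_mod_cast Finset.card_le_card (Finset.filter_subset _ _)
        _ = D := by
            rw [h𝒟, Nat.card_Ioc]
            norm_num
            omega
    -- the other terms: `y ≠ x` in the support gives `n ≠ 0`, `|n| ≤ 4RS`, and `p ∣ y.1`
    have hother : ∑ y ∈ B.erase x, (if β y.1 y.2 ≠ 0 then (N x y : ℝ) else 0) ≤
        ∑ y ∈ B.erase x, (if p ∣ y.1 then T else 0) := by
      refine Finset.sum_le_sum fun y hy => ?_
      obtain ⟨hyx, hyB⟩ := Finset.mem_erase.mp hy
      rw [hB, Finset.mem_product, Finset.mem_Ioc, Finset.mem_Ioc] at hyB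
      by_cases hβy : β y.1 y.2 = 0
      · rw [if_neg (not_not.mpr hβy)]
        split_ifs
        · exact hT0
        · exact le_rfl
      · rw [if_pos hβy, if_pos (hβp _ _ hβy)]
        have hn0 : (y.1 : ℤ) * x.2 - (x.1 : ℤ) * y.2 ≠ 0 := by
          intro h0
          apply hyx
          have h0' : y.1 * x.2 = x.1 * y.2 := by
            have : (y.1 : ℤ) * x.2 = (x.1 : ℤ) * y.2 := by linarith
            exact_mod_cast this
          exact eq_of_coprime_of_mul_eq hx0 (hβc _ _ hβx) (hβc _ _ hβy) h0'
        have hnle : |(y.1 : ℤ) * x.2 - (x.1 : ℤ) * y.2| ≤ 4 * R * S := by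
          have h1 : y.1 * x.2 ≤ 2 * R * (2 * S) := Nat.mul_le_mul hyB.1.2 hxB.2.2
          have h2 : x.1 * y.2 ≤ 2 * R * (2 * S) := Nat.mul_le_mul hxB.1.2 hyB.2.2
          rw [abs_le]
          constructor
          · have : ((x.1 * y.2 : ℕ) : ℤ) ≤ ((2 * R * (2 * S) : ℕ) : ℤ) := by exact_mod_cast h2
            push_cast at this
            nlinarith [this, Nat.cast_nonneg (α := ℤ) (y.1 * x.2)]
          · have : ((y.1 * x.2 : ℕ) : ℤ) ≤ ((2 * R * (2 * S) : ℕ) : ℤ) := by exact_mod_cast h1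
            push_cast at this
            nlinarith [this, Nat.cast_nonneg (α := ℤ) (x.1 * y.2)]
        simp only [hN]
        exact hT _ hn0 hnle
    -- the multiples of `p`
    have hcount : ∑ y ∈ B.erase x, (if p ∣ y.1 then T else 0) ≤ ((R : ℝ) / p + 1) * S * T := by
      calc ∑ y ∈ B.erase x, (if p ∣ y.1 then T else 0) ≤ ∑ y ∈ B, (if p ∣ y.1 then T else 0) :=
            Finset.sum_le_sum_of_subset_of_nonneg (Finset.erase_subset _ _) fun _ _ _ => by
              split_ifs
              · exact hT0
              · exact le_rfl
        _ = #(B.filter fun y => p ∣ y.1) * T := by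
            rw [← Finset.sum_filter, Finset.sum_const, nsmul_eq_mul]
        _ = #((Ioc R (2 * R)).filter fun r => p ∣ r) * #(Ioc S (2 * S)) * T := by
            rw [hB, Finset.filter_product_left, Finset.card_product, Nat.cast_mul]
        _ ≤ ((R : ℝ) / p + 1) * S * T := by
            refine mul_le_mul_of_nonneg_right ?_ hT0
            have hS : (#(Ioc S (2 * S)) : ℝ) = S := by rw [Nat.card_Ioc]; norm_num; omega
            rw [hS]
            refine mul_le_mul_of_nonneg_right ?_ (Nat.cast_nonneg _)
            calc (#((Ioc R (2 * R)).filter fun r => p ∣ r) : ℝ) ≤ ((R / p + 1 : ℕ) : ℝ) := by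
                  exact_mod_cast card_Ioc_filter_dvd_le R hp.pos
              _ ≤ (R : ℝ) / p + 1 := by
                  push_cast
                  have : ((R / p : ℕ) : ℝ) ≤ (R : ℝ) / p := Nat.cast_div_le
                  linarith
    rw [hK]
    linarith [hNxx, hother, hcount]
  -- Step 6: assemble
  have h6 : ∑ x ∈ B, ∑ y ∈ B, A x y ≤ ∑ x ∈ B, ‖β x.1 x.2‖ ^ 2 * K := by
    refine Finset.sum_le_sum fun x hx => ?_
    simp only [hA]
    rw [← Finset.mul_sum]
    by_cases hβx : β x.1 x.2 = 0
    · rw [hβx, norm_zero]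
      simp
    · exact mul_le_mul_of_nonneg_left (h5 x hx hβx) (by positivity)
  calc ∑ d ∈ 𝒟, ∑ a ∈ range d, ‖∑ r ∈ Ioc R (2 * R), ∑ s ∈ Ioc S (2 * S),
        (if r.Coprime d ∧ (d : ℤ) ∣ (s : ℤ) - (a : ℤ) * r then β r s * (jtChar d r : ℂ) else 0)‖ ^ 2
      ≤ ∑ d ∈ 𝒟, ∑ x ∈ B, ∑ y ∈ B, (if (d : ℤ) ∣ (y.1 : ℤ) * x.2 - (x.1 : ℤ) * y.2
          then ‖β x.1 x.2‖ * ‖β y.1 y.2‖ else 0) := Finset.sum_le_sum h12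
    _ = ∑ x ∈ B, ∑ y ∈ B, ‖β x.1 x.2‖ * ‖β y.1 y.2‖ * (N x y : ℝ) := h3
    _ ≤ ∑ x ∈ B, ∑ y ∈ B, A x y := h4
    _ ≤ ∑ x ∈ B, ‖β x.1 x.2‖ ^ 2 * K := h6
    _ = K * ∑ r ∈ Ioc R (2 * R), ∑ s ∈ Ioc S (2 * S), ‖β r s‖ ^ 2 := by
        rw [← Finset.sum_mul, mul_comm, hB, Finset.sum_product]

/-- The number of divisors of a non-zero `n` in `(D, 2D]` is at most `τ(|n|) ≤ C_ε |n|^ε`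
(the tree's `DivisorBound`). [folklore] -/
private theorem card_filter_dvd_le_rpow {ε : ℝ} {C : ℝ} (hC : ∀ n : ℕ, (#n.divisors : ℝ) ≤ C * (n : ℝ) ^ ε)
    (D : ℕ) {n : ℤ} (hn : n ≠ 0) :
    (#((Ioc D (2 * D)).filter fun d : ℕ => (d : ℤ) ∣ n) : ℝ) ≤ C * (n.natAbs : ℝ) ^ ε := by
  refine le_trans ?_ (hC n.natAbs)
  exact_mod_cast Finset.card_le_card fun d hd => by
    rw [Finset.mem_filter] at hd
    rw [Nat.mem_divisors]
    exact ⟨Int.natCast_dvd.mp hd.2, Int.natAbs_ne_zero.mpr hn⟩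

/-- **The trivial estimate with the divisor bound**: for every `ε > 0` there is `C ≥ 1` (the
constant of `τ(n) ≤ C n^ε`) such that, for all `D, R, S`, primes `p` and coefficients `β_{rs}`
supported on `p ∣ r`, `(r, s) = 1`:
`V_β(D) ≤ (D + (R/p + 1) S · C (4RS)^ε) ‖β‖²` — the printed `≪ {D + p⁻¹(RS)^{1+ε}} ‖β‖²`.
[cite: FriedlanderIwaniecAnnals1998, §13 after (13.1)] -/
theorem jtV_le_trivial_of_dvd_rpow {ε : ℝ} (hε : 0 < ε) :
    ∃ C : ℝ, 1 ≤ C ∧ ∀ (D R S : ℕ) {p : ℕ}, p.Prime → ∀ β : ℕ → ℕ → ℂ,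
      (∀ r s, β r s ≠ 0 → p ∣ r) → (∀ r s, β r s ≠ 0 → r.Coprime s) →
      jtV D (2 * D) R S β ≤ ((D : ℝ) + ((R : ℝ) / p + 1) * S * (C * ((4 : ℝ) * R * S) ^ ε)) *
        ∑ r ∈ Ioc R (2 * R), ∑ s ∈ Ioc S (2 * S), ‖β r s‖ ^ 2 := by
  obtain ⟨C, hC1, hC⟩ := Literature.NumberTheory.Sieve.exists_card_divisors_le_mul_rpow' hε
  refine ⟨C, hC1, fun D R S p hp β hβp hβc => ?_⟩
  refine jtV_le_trivial_of_dvd D R S hp β hβp hβc (by positivity) fun n hn hnle => ?_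
  refine (card_filter_dvd_le_rpow hC D hn).trans ?_
  refine mul_le_mul_of_nonneg_left ?_ (by linarith)
  refine Real.rpow_le_rpow (Nat.cast_nonneg _) ?_ hε.le
  have : ((n.natAbs : ℕ) : ℤ) ≤ 4 * R * S := by rw [Int.natCast_natAbs]; exact hnle
  exact_mod_cast this

end Trivial

/-! ### (13.2)/(13.4) before the choice of `P` -/

/-- **Averaging the enlargement over primes** ((13.2) with (13.3) inserted, i.e. (13.4) before
estimating the prime sums): for a finite set of primes `𝒫` and weights `w_p ≥ 0`,
`(Σ_p w_p) V(D) ≤ 2 Σ_p w_p p² V(Dp²) + 2 Σ_p w_p V'_p(D)`.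
[cite: FriedlanderIwaniecAnnals1998, (13.2)-(13.4)] -/
theorem jtV_weighted_le_enlarged (D R S : ℕ) (Pr : Finset ℕ) (hPr : ∀ p ∈ Pr, p.Prime) (w : ℕ → ℝ)
    (hw : ∀ p ∈ Pr, 0 ≤ w p) (α : ℕ → ℕ → ℂ) :
    (∑ p ∈ Pr, w p) * jtV D (2 * D) R S α ≤
      2 * ∑ p ∈ Pr, w p * (p : ℝ) ^ 2 * jtV (D * p ^ 2) (2 * (D * p ^ 2)) R S α +
      2 * ∑ p ∈ Pr, w p * jtV D (2 * D) R S (fun r s => if p ∣ r then α r s else 0) := by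
  rw [Finset.sum_mul, Finset.mul_sum, Finset.mul_sum, ← Finset.sum_add_distrib]
  refine Finset.sum_le_sum fun p hp => ?_
  have h := jtV_le_enlarged D R S (hPr p hp) α
  have hw0 := hw p hp
  nlinarith [h, hw0]

/-! ### Keeping the moduli `dp²` sparse: the faithful form of (13.4) -/

/-- **(13.3) summed over `d`, sparse form**: `V_{p∤r}(D) ≤ p² Σ_{D<d≤2D} E(dp²)`, the right side
being the variance of `α` over the moduli `dp²` only. [cite: FriedlanderIwaniecAnnals1998, (13.3)] -/
theorem jtV_notDvd_le_sq_mul_sparse (D R S : ℕ) {p : ℕ} (hp : p.Prime) (α : ℕ → ℕ → ℂ) :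
    jtV D (2 * D) R S (fun r s => if p ∣ r then 0 else α r s) ≤
      (p : ℝ) ^ 2 * ∑ d ∈ Ioc D (2 * D), ∑ a ∈ range (d * p ^ 2),
        ‖∑ r ∈ Ioc R (2 * R), ∑ s ∈ Ioc S (2 * S),
          (if r.Coprime (d * p ^ 2) ∧ ((d * p ^ 2 : ℕ) : ℤ) ∣ (s : ℤ) - (a : ℤ) * r
            then α r s * (jtChar (d * p ^ 2) r : ℂ) else 0)‖ ^ 2 := by
  rw [jtV_def, Finset.mul_sum]
  refine Finset.sum_le_sum fun d hd => ?_
  have hd0 : 0 < d := lt_of_le_of_lt (Nat.zero_le D) (Finset.mem_Ioc.mp hd).1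
  refine le_trans (le_of_eq ?_) (jtLocal_notDvd_le_sq_mul hd0 hp R S α)
  refine Finset.sum_congr rfl fun a _ => ?_
  congr 2
  refine Finset.sum_congr rfl fun r _ => Finset.sum_congr rfl fun s _ => ?_
  by_cases hpr : p ∣ r
  · simp [hpr]
  · simp [hpr]

/-- **The moduli `dp²` are distinct and lie in `(DP², 8DP²]`**: for primes `p ∈ (P, 2P]` and
`D < d ≤ 2D` with `2D < P²`, the map `(p, d) ↦ dp²` is injective (if `d₁p₁² = d₂p₂²` with
`p₁ ≠ p₂` then `p₂² ∣ d₁`, so `d₁ ≥ p₂² > P² > 2D`); hence for `G ≥ 0`,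
`Σ_p Σ_d G(dp²) ≤ Σ_{DP² < m ≤ 8DP²} G(m)` ("for some `D⁺` with `DP² ≤ D⁺ ≤ 4DP²` … Actually `D⁺`
may be taken to be `2^j DP²` for one of `j = 0, 1, 2`"). [cite: FriedlanderIwaniecAnnals1998, (13.4)] -/
theorem sum_primes_sum_Ioc_sq_le {P D : ℕ} (Pr : Finset ℕ) (hPr : ∀ p ∈ Pr, p.Prime ∧ P < p ∧ p ≤ 2 * P)
    (hDP : 2 * D < P ^ 2) {G : ℕ → ℝ} (hG : ∀ m, 0 ≤ G m) :
    ∑ p ∈ Pr, ∑ d ∈ Ioc D (2 * D), G (d * p ^ 2) ≤ ∑ m ∈ Ioc (D * P ^ 2) (8 * (D * P ^ 2)), G m := by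
  rw [← Finset.sum_product' (f := fun p d => G (d * p ^ 2))]
  have hinj : Set.InjOn (fun x : ℕ × ℕ => x.2 * x.1 ^ 2) ↑(Pr ×ˢ Ioc D (2 * D)) := by
    rintro ⟨p₁, d₁⟩ h₁ ⟨p₂, d₂⟩ h₂ h
    rw [Finset.mem_coe, Finset.mem_product, Finset.mem_Ioc] at h₁ h₂
    dsimp only at h h₁ h₂
    obtain ⟨hp₁, hP₁, -⟩ := hPr p₁ h₁.1
    obtain ⟨hp₂, hP₂, -⟩ := hPr p₂ h₂.1
    by_cases hpp : p₁ = p₂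
    · subst hpp
      have := Nat.eq_of_mul_eq_mul_right (pow_pos hp₁.pos 2) h
      rw [this]
    · exfalso
      -- `p₂² ∣ d₁ p₁²` and `(p₂², p₁²) = 1` give `p₂² ∣ d₁`
      have hcop : (p₂ ^ 2).Coprime (p₁ ^ 2) :=
        Nat.Coprime.pow 2 2 ((Nat.coprime_primes hp₂ hp₁).mpr (Ne.symm hpp))
      have hdvd : p₂ ^ 2 ∣ d₁ := hcop.dvd_of_dvd_mul_right (Dvd.intro d₂ (by rw [h]; ring))
      have hle : p₂ ^ 2 ≤ d₁ := Nat.le_of_dvd (lt_of_le_of_lt (Nat.zero_le D) h₁.2.1) hdvd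
      have hP2 : P ^ 2 < p₂ ^ 2 := Nat.pow_lt_pow_left hP₂ two_ne_zero
      have := h₁.2.2
      omega
  rw [← Finset.sum_image hinj]
  refine Finset.sum_le_sum_of_subset_of_nonneg (fun m hm => ?_) fun m _ _ => hG m
  rw [Finset.mem_image] at hm
  obtain ⟨⟨p, d⟩, hx, rfl⟩ := hm
  rw [Finset.mem_product, Finset.mem_Ioc] at hx
  obtain ⟨-, hP₁, hP₂⟩ := hPr p hx.1
  dsimp only
  rw [Finset.mem_Ioc]
  constructor
  · have h1 : P ^ 2 < p ^ 2 := Nat.pow_lt_pow_left hP₁ two_ne_zero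
    calc D * P ^ 2 ≤ D * p ^ 2 := Nat.mul_le_mul_left _ h1.le
      _ < d * p ^ 2 := Nat.mul_lt_mul_of_pos_right hx.2.1 (pow_pos (lt_of_le_of_lt (Nat.zero_le P) hP₁) 2)
  · have h2 : p ^ 2 ≤ (2 * P) ^ 2 := Nat.pow_le_pow_left hP₂ 2
    calc d * p ^ 2 ≤ 2 * D * (2 * P) ^ 2 := Nat.mul_le_mul hx.2.2 h2
      _ = 8 * (D * P ^ 2) := by ring

/-- **The principle of enlarging moduli, assembled** ((13.1)–(13.4) with the prime sums left as
parameters): for a finite set `Pr` of primes in `(P, 2P]` with `2D < P²`, weights `w_p ≥ 0` with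
`w_p p² ≤ W` (`W ≥ 0`), and any coefficients `α`,
`(Σ_p w_p) V(D) ≤ 2W · V_{(DP², 8DP²]}(α) + 2 Σ_p w_p V'_p(D)`,
where `V_{(DP², 8DP²]} = jtV (DP²) (8DP²)` is the variance over ALL moduli in `(DP², 8DP²]` (the
three dyadic ranges `2^jDP²`, `j = 0, 1, 2`, of the source) and `V'_p` is the variance of
`α_{rs}[p ∣ r]`, estimated by `jtV_le_trivial_of_dvd`. With `w_p = p⁻¹ log p`, `W = 2P⁻¹… · (2P)²`
this is the printed (13.4) `V(D) ≪ V(D⁺) P log DP + (DP⁻¹ + P⁻²RS)(RS)^ε ‖α‖²` up to the prime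
number sums `Σ_{p∼P} p⁻¹ log p ≫ 1`. [cite: FriedlanderIwaniecAnnals1998, (13.4)] -/
theorem jtV_weighted_le_enlarged_sparse {P D : ℕ} (R S : ℕ) (Pr : Finset ℕ)
    (hPr : ∀ p ∈ Pr, p.Prime ∧ P < p ∧ p ≤ 2 * P) (hDP : 2 * D < P ^ 2) (w : ℕ → ℝ)
    (hw : ∀ p ∈ Pr, 0 ≤ w p) {W : ℝ} (hW0 : 0 ≤ W) (hW : ∀ p ∈ Pr, w p * (p : ℝ) ^ 2 ≤ W)
    (α : ℕ → ℕ → ℂ) :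
    (∑ p ∈ Pr, w p) * jtV D (2 * D) R S α ≤
      2 * W * jtV (D * P ^ 2) (8 * (D * P ^ 2)) R S α +
      2 * ∑ p ∈ Pr, w p * jtV D (2 * D) R S (fun r s => if p ∣ r then α r s else 0) := by
  -- the modulus-`m` term of the variance
  set G : ℕ → ℝ := fun m => ∑ a ∈ range m, ‖∑ r ∈ Ioc R (2 * R), ∑ s ∈ Ioc S (2 * S),
      (if r.Coprime m ∧ (m : ℤ) ∣ (s : ℤ) - (a : ℤ) * r then α r s * (jtChar m r : ℂ) else 0)‖ ^ 2
    with hG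
  have hG0 : ∀ m, 0 ≤ G m := fun m => by simp only [hG]; positivity
  -- per prime: (13.1) + sparse (13.3)
  have hper : ∀ p ∈ Pr, w p * jtV D (2 * D) R S α ≤
      2 * (W * ∑ d ∈ Ioc D (2 * D), G (d * p ^ 2)) +
      2 * (w p * jtV D (2 * D) R S (fun r s => if p ∣ r then α r s else 0)) := by
    intro p hp
    have hprime := (hPr p hp).1
    have hsplit : α = (fun r s => if p ∣ r then 0 else α r s) + fun r s => if p ∣ r then α r s else 0 := by
      funext r s
      simp only [Pi.add_apply]
      split_ifs <;> simp
    have h1 := jtV_add_le D (2 * D) R S (fun r s => if p ∣ r then 0 else α r s)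
      (fun r s => if p ∣ r then α r s else 0)
    rw [← hsplit] at h1
    have h2 := jtV_notDvd_le_sq_mul_sparse D R S hprime α
    have hsum0 : 0 ≤ ∑ d ∈ Ioc D (2 * D), G (d * p ^ 2) := Finset.sum_nonneg fun d _ => hG0 _
    have h3 : w p * ((p : ℝ) ^ 2 * ∑ d ∈ Ioc D (2 * D), G (d * p ^ 2)) ≤
        W * ∑ d ∈ Ioc D (2 * D), G (d * p ^ 2) := by
      rw [← mul_assoc]
      exact mul_le_mul_of_nonneg_right (hW p hp) hsum0
    have hwp := hw p hp
    have h4 : w p * jtV D (2 * D) R S (fun r s => if p ∣ r then 0 else α r s) ≤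
        W * ∑ d ∈ Ioc D (2 * D), G (d * p ^ 2) :=
      le_trans (mul_le_mul_of_nonneg_left h2 hwp) h3
    nlinarith [h1, h4, hwp]
  -- sum over `p` and collect the sparse moduli into `(DP², 8DP²]`
  have hcollect : ∑ p ∈ Pr, ∑ d ∈ Ioc D (2 * D), G (d * p ^ 2) ≤ jtV (D * P ^ 2) (8 * (D * P ^ 2)) R S α := by
    rw [jtV_def]
    exact sum_primes_sum_Ioc_sq_le Pr hPr hDP hG0
  calc (∑ p ∈ Pr, w p) * jtV D (2 * D) R S α = ∑ p ∈ Pr, w p * jtV D (2 * D) R S α := by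
        rw [Finset.sum_mul]
    _ ≤ ∑ p ∈ Pr, (2 * (W * ∑ d ∈ Ioc D (2 * D), G (d * p ^ 2)) +
          2 * (w p * jtV D (2 * D) R S (fun r s => if p ∣ r then α r s else 0))) :=
        Finset.sum_le_sum hper
    _ = 2 * W * ∑ p ∈ Pr, ∑ d ∈ Ioc D (2 * D), G (d * p ^ 2) +
          2 * ∑ p ∈ Pr, w p * jtV D (2 * D) R S (fun r s => if p ∣ r then α r s else 0) := by
        rw [Finset.sum_add_distrib, ← Finset.mul_sum, ← Finset.mul_sum, ← Finset.mul_sum, mul_assoc]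
    _ ≤ 2 * W * jtV (D * P ^ 2) (8 * (D * P ^ 2)) R S α +
          2 * ∑ p ∈ Pr, w p * jtV D (2 * D) R S (fun r s => if p ∣ r then α r s else 0) := by
        have := mul_le_mul_of_nonneg_left hcollect (by positivity : (0 : ℝ) ≤ 2 * W)
        linarith

/-! ### The prime number sum of (13.2), and (13.4) with explicit constants -/

/-- `θ(2P) - θ(P) = Σ_{P < p ≤ 2P} log p`. [folklore] -/
private theorem theta_two_mul_sub_theta (P : ℕ) :
    Chebyshev.theta ((2 * P : ℕ) : ℝ) - Chebyshev.theta (P : ℝ) =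
      ∑ p ∈ (Ioc P (2 * P)).filter Nat.Prime, Real.log p := by
  unfold Chebyshev.theta
  rw [Nat.floor_natCast, Nat.floor_natCast, Finset.sum_filter, Finset.sum_filter, Finset.sum_filter,
    ← Finset.sum_Ioc_consecutive _ (Nat.zero_le P) (by omega : P ≤ 2 * P)]
  ring

/-- **The prime number sum of (13.2)**: `Σ_{P<p≤2P} p⁻¹ log p ≥ 1/4` for all large `P` ("multiplying
(13.1) through by `p⁻¹ log p` and summing over `P < p ≤ 2P`"; from the prime number theorem
`θ(X) = X + o(X)` of the tree, via `θ(2P) - θ(P) ≥ P/2`).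
[cite: FriedlanderIwaniecAnnals1998, (13.2)] -/
theorem quarter_le_sum_primes_log_div :
    ∃ P₀ : ℕ, ∀ P : ℕ, P₀ ≤ P →
      (1 : ℝ) / 4 ≤ ∑ p ∈ (Ioc P (2 * P)).filter Nat.Prime, Real.log p / p := by
  have h := Literature.NumberTheory.LFunctions.chebyshevTheta_sub_self_isLittleO.def
    (by norm_num : (0 : ℝ) < 1 / 6)
  rw [Filter.eventually_atTop] at h
  obtain ⟨X₀, hX₀⟩ := h
  refine ⟨X₀ + 1, fun P hP => ?_⟩
  have hP0 : 0 < P := by omega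
  have h1 := hX₀ P (by omega)
  have h2 := hX₀ (2 * P) (by omega)
  set T1 := Chebyshev.theta (P : ℝ) with hT1
  set T2 := Chebyshev.theta ((2 * P : ℕ) : ℝ) with hT2
  rw [Real.norm_eq_abs, Real.norm_eq_abs, abs_of_nonneg (Nat.cast_nonneg (α := ℝ) P)] at h1
  rw [Real.norm_eq_abs, Real.norm_eq_abs, abs_of_nonneg (Nat.cast_nonneg (α := ℝ) (2 * P))] at h2
  have e : ((2 * P : ℕ) : ℝ) = 2 * P := by push_cast; ring
  rw [e] at h2
  have hdiff : (P : ℝ) / 2 ≤ T2 - T1 := by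
    have a1 := (abs_le.mp h1).2
    have a2 := (abs_le.mp h2).1
    linarith
  have hsum : T2 - T1 = ∑ p ∈ (Ioc P (2 * P)).filter Nat.Prime, Real.log p := by
    rw [hT2, hT1]; exact theta_two_mul_sub_theta P
  have hP' : (0 : ℝ) < 2 * P := by positivity
  calc (1 : ℝ) / 4 = ((P : ℝ) / 2) / (2 * P) := by field_simp; ring
    _ ≤ (∑ p ∈ (Ioc P (2 * P)).filter Nat.Prime, Real.log p) / (2 * P) :=
        div_le_div_of_nonneg_right (hsum ▸ hdiff) hP'.le
    _ = ∑ p ∈ (Ioc P (2 * P)).filter Nat.Prime, Real.log p / (2 * P) := by rw [Finset.sum_div]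
    _ ≤ ∑ p ∈ (Ioc P (2 * P)).filter Nat.Prime, Real.log p / p := by
        refine Finset.sum_le_sum fun p hp => ?_
        obtain ⟨hpI, hpp⟩ := Finset.mem_filter.mp hp
        rw [Finset.mem_Ioc] at hpI
        exact div_le_div_of_nonneg_left (Real.log_nonneg (by exact_mod_cast hpp.one_lt.le))
          (by exact_mod_cast hpp.pos) (by exact_mod_cast hpI.2)

/-- `V ≥ 0`. [folklore] -/
private theorem jtV_nonneg' (D₁ D₂ R S : ℕ) (α : ℕ → ℕ → ℂ) : 0 ≤ jtV D₁ D₂ R S α := by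
  rw [jtV_def]; positivity

/-- **The principle of enlarging moduli (13.4), explicit form**: there is `P₀` such that for all
`P ≥ P₀`, all `D` with `2D < P²`, all `R, S` and all coefficients `α_{rs}`,
`V(D) ≤ 16 P log(2P) · V_{(DP², 8DP²]}(α) + 8 Σ_{P<p≤2P} p⁻¹ log p · V'_p(D)`,
where `V_{(DP², 8DP²]} = jtV (DP²) (8DP²)` ("`V(D⁺)`, `D⁺ = 2^jDP²`, `j = 0, 1, 2`") and `V'_p(D)` is
the variance of `α_{rs}[p ∣ r]` (bounded by `jtV_le_trivial_of_dvd`: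
`≪ {D + p⁻¹(RS)^{1+ε}} Σ|α_{prs}|²`) — the printed
`V(D) ≪ V(D⁺) P log DP + (DP⁻¹ + P⁻²RS)(RS)^ε ‖α‖²`. [cite: FriedlanderIwaniecAnnals1998, (13.4)] -/
theorem jtV_le_enlarged_principle :
    ∃ P₀ : ℕ, ∀ (P D R S : ℕ), P₀ ≤ P → 2 * D < P ^ 2 → ∀ α : ℕ → ℕ → ℂ,
      jtV D (2 * D) R S α ≤
        16 * P * Real.log (2 * P) * jtV (D * P ^ 2) (8 * (D * P ^ 2)) R S α +
        8 * ∑ p ∈ (Ioc P (2 * P)).filter Nat.Prime,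
          Real.log p / p * jtV D (2 * D) R S (fun r s => if p ∣ r then α r s else 0) := by
  obtain ⟨P₀, hP₀⟩ := quarter_le_sum_primes_log_div
  refine ⟨P₀ + 1, fun P D R S hP hDP α => ?_⟩
  have hP1 : 1 ≤ P := by omega
  have hquarter := hP₀ P (by omega)
  set Pr := (Ioc P (2 * P)).filter Nat.Prime with hPr
  have hPr' : ∀ p ∈ Pr, p.Prime ∧ P < p ∧ p ≤ 2 * P := by
    intro p hp
    rw [hPr, Finset.mem_filter, Finset.mem_Ioc] at hp
    exact ⟨hp.2, hp.1.1, hp.1.2⟩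
  have hlog2P : 0 ≤ Real.log (2 * P) := Real.log_nonneg (by
    have : (1 : ℝ) ≤ P := by exact_mod_cast hP1
    linarith)
  have hw : ∀ p ∈ Pr, 0 ≤ Real.log p / p := fun p hp =>
    div_nonneg (Real.log_nonneg (by exact_mod_cast (hPr' p hp).1.one_lt.le)) (Nat.cast_nonneg _)
  have hW : ∀ p ∈ Pr, Real.log p / p * (p : ℝ) ^ 2 ≤ 2 * P * Real.log (2 * P) := by
    intro p hp
    obtain ⟨hpp, hP₁, hP₂⟩ := hPr' p hp
    have hp0 : (0 : ℝ) < p := by exact_mod_cast hpp.pos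
    have hp2 : (p : ℝ) ≤ 2 * P := by exact_mod_cast hP₂
    have hlogp : Real.log p ≤ Real.log (2 * P) := Real.log_le_log hp0 hp2
    have hlogp0 : 0 ≤ Real.log p := Real.log_nonneg (by exact_mod_cast hpp.one_lt.le)
    have e1 : Real.log p / p * (p : ℝ) ^ 2 = Real.log p * p := by
      field_simp
    rw [e1]
    calc Real.log p * p ≤ Real.log (2 * P) * (2 * P) :=
          mul_le_mul hlogp hp2 hp0.le hlog2P
      _ = 2 * P * Real.log (2 * P) := by ring
  have hmain := jtV_weighted_le_enlarged_sparse R S Pr hPr' hDP (fun p => Real.log p / p) hw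
    (by positivity : (0 : ℝ) ≤ 2 * P * Real.log (2 * P)) hW α
  have hV0 := jtV_nonneg' D (2 * D) R S α
  have hV1 := jtV_nonneg' (D * P ^ 2) (8 * (D * P ^ 2)) R S α
  have hS0 : 0 ≤ ∑ p ∈ Pr, Real.log p / p *
      jtV D (2 * D) R S (fun r s => if p ∣ r then α r s else 0) :=
    Finset.sum_nonneg fun p hp => mul_nonneg (hw p hp) (jtV_nonneg' _ _ _ _ _)
  -- `(1/4) V ≤ (Σ w) V ≤ 2W V⁺ + 2 Σ w V'`
  have h14 : (1 : ℝ) / 4 * jtV D (2 * D) R S α ≤ (∑ p ∈ Pr, Real.log p / p) * jtV D (2 * D) R S α :=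
    mul_le_mul_of_nonneg_right hquarter hV0
  nlinarith [hmain, h14, hV1, hS0, hlog2P]

/-! ### The general multiplicity count: (13.4) for all `D` -/

/-- **Multiplicity of the representations `m = dp²`**: for primes `p ∈ (P, 2P]` (`P ≥ 2`) and
`0 < m ≤ 8DP²`, at most `1 + ⌊log_P(8D)/2⌋` of them have `p² ∣ m` (their squares are pairwise
coprime, so the product of `k` of them, `> P^{2k}`, divides `m`). [folklore] -/
private theorem card_primes_sq_dvd_le {P D m : ℕ} (hP : 2 ≤ P) (Pr : Finset ℕ)
    (hPr : ∀ p ∈ Pr, p.Prime ∧ P < p ∧ p ≤ 2 * P) (hm0 : m ≠ 0) (hm : m ≤ 8 * (D * P ^ 2)) :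
    #(Pr.filter fun p => p ^ 2 ∣ m) ≤ 1 + Nat.log P (8 * D) / 2 := by
  set T := Pr.filter fun p => p ^ 2 ∣ m with hT
  -- the product of the squares divides `m`
  have key : ∀ U : Finset ℕ, U ⊆ T → (∏ p ∈ U, p ^ 2) ∣ m := fun U =>
    Finset.induction_on U (fun _ => by simp) fun a U haU ih hU => by
      rw [Finset.prod_insert haU]
      have haT := hU (Finset.mem_insert_self a U)
      have hUT : U ⊆ T := fun x hx => hU (Finset.mem_insert_of_mem hx)
      refine Nat.Coprime.mul_dvd_of_dvd_of_dvd ?_ (Finset.mem_filter.mp haT).2 (ih hUT)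
      refine Nat.Coprime.prod_right fun b hb => Nat.Coprime.pow 2 2 ?_
      have ha := (hPr a (Finset.mem_filter.mp haT).1).1
      have hbp := (hPr b (Finset.mem_filter.mp (hUT hb)).1).1
      exact (Nat.coprime_primes ha hbp).mpr fun h => haU (h ▸ hb)
  have hdvd := key T le_rfl
  have hle : (∏ p ∈ T, p ^ 2) ≤ 8 * (D * P ^ 2) := (Nat.le_of_dvd (Nat.pos_of_ne_zero hm0) hdvd).trans hm
  -- `(P+1)^{2k} ≤ ∏ p²`
  have hpow : ((P + 1) ^ 2) ^ #T ≤ ∏ p ∈ T, p ^ 2 :=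
    Finset.pow_card_le_prod T (fun p => p ^ 2) ((P + 1) ^ 2) fun p hp =>
      Nat.pow_le_pow_left (hPr p (Finset.mem_filter.mp hp).1).2.1 2
  set k := #T with hk
  rcases Nat.eq_zero_or_pos k with hk0 | hk1
  · omega
  · -- `P^{2(k-1)} · P² ≤ P^{2k} < (P+1)^{2k} ≤ 8DP²`, so `P^{2(k-1)} < 8D`
    have h1 : P ^ (2 * k) < (P + 1) ^ (2 * k) := Nat.pow_lt_pow_left (Nat.lt_succ_self P) (by omega)
    rw [← pow_mul] at hpow
    have h2 : P ^ (2 * (k - 1)) * P ^ 2 = P ^ (2 * k) := by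
      rw [← pow_add]; congr 1; omega
    have h3 : P ^ (2 * (k - 1)) * P ^ 2 < 8 * D * P ^ 2 := by
      rw [h2]; calc P ^ (2 * k) < (P + 1) ^ (2 * k) := h1
        _ ≤ 8 * (D * P ^ 2) := hpow.trans hle
        _ = 8 * D * P ^ 2 := by ring
    have h4 : P ^ (2 * (k - 1)) < 8 * D := Nat.lt_of_mul_lt_mul_right h3
    have h5 : 2 * (k - 1) ≤ Nat.log P (8 * D) := Nat.le_log_of_pow_le (by omega) h4.le
    omega

/-- **Collecting the moduli `dp²` with multiplicity**: for primes `p ∈ (P, 2P]` (`P ≥ 2`), any `D`,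
and `G ≥ 0`, `Σ_p Σ_{D<d≤2D} G(dp²) ≤ (1 + ⌊log_P(8D)/2⌋) Σ_{DP² < m ≤ 8DP²} G(m)`.
[cite: FriedlanderIwaniecAnnals1998, (13.4)] -/
theorem sum_primes_sum_Ioc_sq_le_mul {P D : ℕ} (hP : 2 ≤ P) (Pr : Finset ℕ)
    (hPr : ∀ p ∈ Pr, p.Prime ∧ P < p ∧ p ≤ 2 * P) {G : ℕ → ℝ} (hG : ∀ m, 0 ≤ G m) :
    ∑ p ∈ Pr, ∑ d ∈ Ioc D (2 * D), G (d * p ^ 2) ≤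
      ((1 + Nat.log P (8 * D) / 2 : ℕ) : ℝ) * ∑ m ∈ Ioc (D * P ^ 2) (8 * (D * P ^ 2)), G m := by
  rw [← Finset.sum_product' (f := fun p d => G (d * p ^ 2))]
  set s := Pr ×ˢ Ioc D (2 * D) with hs
  set t := Ioc (D * P ^ 2) (8 * (D * P ^ 2)) with ht
  have hmaps : ∀ x ∈ s, x.2 * x.1 ^ 2 ∈ t := by
    rintro ⟨p, d⟩ hx
    rw [hs, Finset.mem_product, Finset.mem_Ioc] at hx
    obtain ⟨-, hP₁, hP₂⟩ := hPr p hx.1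
    dsimp only
    rw [ht, Finset.mem_Ioc]
    constructor
    · have h1 : P ^ 2 < p ^ 2 := Nat.pow_lt_pow_left hP₁ two_ne_zero
      calc D * P ^ 2 ≤ D * p ^ 2 := Nat.mul_le_mul_left _ h1.le
        _ < d * p ^ 2 := Nat.mul_lt_mul_of_pos_right hx.2.1 (pow_pos (lt_of_le_of_lt (Nat.zero_le P) hP₁) 2)
    · have h2 : p ^ 2 ≤ (2 * P) ^ 2 := Nat.pow_le_pow_left hP₂ 2
      calc d * p ^ 2 ≤ 2 * D * (2 * P) ^ 2 := Nat.mul_le_mul hx.2.2 h2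
        _ = 8 * (D * P ^ 2) := by ring
  have hfib := Finset.sum_fiberwise_of_maps_to' hmaps (f := G)
  -- `Σ_x G(g x) = Σ_{m ∈ t} #fiber(m) · G(m)`
  have e : ∑ x ∈ s, G (x.2 * x.1 ^ 2) = ∑ m ∈ t, (#(s.filter fun x => x.2 * x.1 ^ 2 = m) : ℝ) * G m := by
    rw [← hfib]
    refine Finset.sum_congr rfl fun m _ => ?_
    rw [Finset.sum_const, nsmul_eq_mul]
  have e' : ∑ x ∈ Pr ×ˢ Ioc D (2 * D), G (x.2 * x.1 ^ 2) = ∑ x ∈ s, G (x.2 * x.1 ^ 2) := rfl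
  rw [e', e, Finset.mul_sum]
  refine Finset.sum_le_sum fun m hm => mul_le_mul_of_nonneg_right ?_ (hG m)
  rw [ht, Finset.mem_Ioc] at hm
  have hm0 : m ≠ 0 := by omega
  -- the fibre injects into the primes with `p² ∣ m`
  have hfiber : #(s.filter fun x => x.2 * x.1 ^ 2 = m) ≤ #(Pr.filter fun p => p ^ 2 ∣ m) := by
    refine Finset.card_le_card_of_injOn Prod.fst (fun x hx => ?_) (fun x hx y hy hxy => ?_)
    · rw [Finset.mem_coe, Finset.mem_filter, hs, Finset.mem_product] at hx
      rw [Finset.mem_coe, Finset.mem_filter]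
      exact ⟨hx.1.1, Dvd.intro_left _ hx.2⟩
    · rw [Finset.mem_coe, Finset.mem_filter, hs, Finset.mem_product] at hx hy
      have hp0 : 0 < x.1 ^ 2 := pow_pos (hPr x.1 hx.1.1).1.pos 2
      have h := hx.2.trans hy.2.symm
      rw [show y.1 = x.1 from hxy.symm] at h
      exact Prod.ext hxy (Nat.eq_of_mul_eq_mul_right hp0 h)
  exact_mod_cast hfiber.trans (card_primes_sq_dvd_le hP Pr hPr hm0 hm.2)

/-- (13.1)–(13.4) averaged over primes, general form with the multiplicity factor:
`(Σ_p w_p) V(D) ≤ 2 W (1 + ⌊log_P(8D)/2⌋) V_{(DP², 8DP²]}(α) + 2 Σ_p w_p V'_p(D)` for primes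
`p ∈ (P, 2P]`, `P ≥ 2`, weights `0 ≤ w_p` with `w_p p² ≤ W`. [cite: FriedlanderIwaniecAnnals1998, (13.4)] -/
theorem jtV_weighted_le_enlarged_mul {P D : ℕ} (hP : 2 ≤ P) (R S : ℕ) (Pr : Finset ℕ)
    (hPr : ∀ p ∈ Pr, p.Prime ∧ P < p ∧ p ≤ 2 * P) (w : ℕ → ℝ)
    (hw : ∀ p ∈ Pr, 0 ≤ w p) {W : ℝ} (hW0 : 0 ≤ W) (hW : ∀ p ∈ Pr, w p * (p : ℝ) ^ 2 ≤ W)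
    (α : ℕ → ℕ → ℂ) :
    (∑ p ∈ Pr, w p) * jtV D (2 * D) R S α ≤
      2 * W * (((1 + Nat.log P (8 * D) / 2 : ℕ) : ℝ) * jtV (D * P ^ 2) (8 * (D * P ^ 2)) R S α) +
      2 * ∑ p ∈ Pr, w p * jtV D (2 * D) R S (fun r s => if p ∣ r then α r s else 0) := by
  set G : ℕ → ℝ := fun m => ∑ a ∈ range m, ‖∑ r ∈ Ioc R (2 * R), ∑ s ∈ Ioc S (2 * S),
      (if r.Coprime m ∧ (m : ℤ) ∣ (s : ℤ) - (a : ℤ) * r then α r s * (jtChar m r : ℂ) else 0)‖ ^ 2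
    with hG
  have hG0 : ∀ m, 0 ≤ G m := fun m => by simp only [hG]; positivity
  have hper : ∀ p ∈ Pr, w p * jtV D (2 * D) R S α ≤
      2 * (W * ∑ d ∈ Ioc D (2 * D), G (d * p ^ 2)) +
      2 * (w p * jtV D (2 * D) R S (fun r s => if p ∣ r then α r s else 0)) := by
    intro p hp
    have hprime := (hPr p hp).1
    have hsplit : α = (fun r s => if p ∣ r then 0 else α r s) + fun r s => if p ∣ r then α r s else 0 := by
      funext r s
      simp only [Pi.add_apply]
      split_ifs <;> simp
    have h1 := jtV_add_le D (2 * D) R S (fun r s => if p ∣ r then 0 else α r s)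
      (fun r s => if p ∣ r then α r s else 0)
    rw [← hsplit] at h1
    have h2 := jtV_notDvd_le_sq_mul_sparse D R S hprime α
    have hsum0 : 0 ≤ ∑ d ∈ Ioc D (2 * D), G (d * p ^ 2) := Finset.sum_nonneg fun d _ => hG0 _
    have h3 : w p * ((p : ℝ) ^ 2 * ∑ d ∈ Ioc D (2 * D), G (d * p ^ 2)) ≤
        W * ∑ d ∈ Ioc D (2 * D), G (d * p ^ 2) := by
      rw [← mul_assoc]
      exact mul_le_mul_of_nonneg_right (hW p hp) hsum0
    have hwp := hw p hp
    have h4 : w p * jtV D (2 * D) R S (fun r s => if p ∣ r then 0 else α r s) ≤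
        W * ∑ d ∈ Ioc D (2 * D), G (d * p ^ 2) :=
      le_trans (mul_le_mul_of_nonneg_left h2 hwp) h3
    nlinarith [h1, h4, hwp]
  have hcollect : ∑ p ∈ Pr, ∑ d ∈ Ioc D (2 * D), G (d * p ^ 2) ≤
      ((1 + Nat.log P (8 * D) / 2 : ℕ) : ℝ) * jtV (D * P ^ 2) (8 * (D * P ^ 2)) R S α := by
    rw [jtV_def]
    exact sum_primes_sum_Ioc_sq_le_mul hP Pr hPr hG0
  calc (∑ p ∈ Pr, w p) * jtV D (2 * D) R S α = ∑ p ∈ Pr, w p * jtV D (2 * D) R S α := by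
        rw [Finset.sum_mul]
    _ ≤ ∑ p ∈ Pr, (2 * (W * ∑ d ∈ Ioc D (2 * D), G (d * p ^ 2)) +
          2 * (w p * jtV D (2 * D) R S (fun r s => if p ∣ r then α r s else 0))) :=
        Finset.sum_le_sum hper
    _ = 2 * W * ∑ p ∈ Pr, ∑ d ∈ Ioc D (2 * D), G (d * p ^ 2) +
          2 * ∑ p ∈ Pr, w p * jtV D (2 * D) R S (fun r s => if p ∣ r then α r s else 0) := by
        rw [Finset.sum_add_distrib, ← Finset.mul_sum, ← Finset.mul_sum, ← Finset.mul_sum, mul_assoc]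
    _ ≤ 2 * W * (((1 + Nat.log P (8 * D) / 2 : ℕ) : ℝ) * jtV (D * P ^ 2) (8 * (D * P ^ 2)) R S α) +
          2 * ∑ p ∈ Pr, w p * jtV D (2 * D) R S (fun r s => if p ∣ r then α r s else 0) := by
        have := mul_le_mul_of_nonneg_left hcollect (by positivity : (0 : ℝ) ≤ 2 * W)
        linarith

/-- **The principle of enlarging moduli (13.4) for all `D`**: there is `P₀` such that for all
`P ≥ P₀` and all `D, R, S`, `α`,
`V(D) ≤ 16 (1 + ⌊log_P(8D)/2⌋) P log(2P) · V_{(DP², 8DP²]}(α) + 8 Σ_{P<p≤2P} p⁻¹ log p · V'_p(D)`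
— the printed `V(D) ≪ V(D⁺) P log DP + …`, the factor `log DP` accounting for both `log P` and the
multiplicity `≪ 1 + log D/log P` of the moduli `dp²`. [cite: FriedlanderIwaniecAnnals1998, (13.4)] -/
theorem jtV_le_enlarged_principle' :
    ∃ P₀ : ℕ, ∀ (P D R S : ℕ), P₀ ≤ P → ∀ α : ℕ → ℕ → ℂ,
      jtV D (2 * D) R S α ≤
        16 * (((1 + Nat.log P (8 * D) / 2 : ℕ) : ℝ)) * P * Real.log (2 * P) *
            jtV (D * P ^ 2) (8 * (D * P ^ 2)) R S α +
        8 * ∑ p ∈ (Ioc P (2 * P)).filter Nat.Prime,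
          Real.log p / p * jtV D (2 * D) R S (fun r s => if p ∣ r then α r s else 0) := by
  obtain ⟨P₀, hP₀⟩ := quarter_le_sum_primes_log_div
  refine ⟨P₀ + 2, fun P D R S hP α => ?_⟩
  have hP2 : 2 ≤ P := by omega
  have hP1 : 1 ≤ P := by omega
  have hquarter := hP₀ P (by omega)
  set Pr := (Ioc P (2 * P)).filter Nat.Prime with hPr
  have hPr' : ∀ p ∈ Pr, p.Prime ∧ P < p ∧ p ≤ 2 * P := by
    intro p hp
    rw [hPr, Finset.mem_filter, Finset.mem_Ioc] at hp
    exact ⟨hp.2, hp.1.1, hp.1.2⟩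
  have hlog2P : 0 ≤ Real.log (2 * P) := Real.log_nonneg (by
    have : (1 : ℝ) ≤ P := by exact_mod_cast hP1
    linarith)
  have hw : ∀ p ∈ Pr, 0 ≤ Real.log p / p := fun p hp =>
    div_nonneg (Real.log_nonneg (by exact_mod_cast (hPr' p hp).1.one_lt.le)) (Nat.cast_nonneg _)
  have hW : ∀ p ∈ Pr, Real.log p / p * (p : ℝ) ^ 2 ≤ 2 * P * Real.log (2 * P) := by
    intro p hp
    obtain ⟨hpp, hP₁, hP₂⟩ := hPr' p hp
    have hp0 : (0 : ℝ) < p := by exact_mod_cast hpp.pos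
    have hp2 : (p : ℝ) ≤ 2 * P := by exact_mod_cast hP₂
    have hlogp : Real.log p ≤ Real.log (2 * P) := Real.log_le_log hp0 hp2
    have hlogp0 : 0 ≤ Real.log p := Real.log_nonneg (by exact_mod_cast hpp.one_lt.le)
    have e1 : Real.log p / p * (p : ℝ) ^ 2 = Real.log p * p := by
      field_simp
    rw [e1]
    calc Real.log p * p ≤ Real.log (2 * P) * (2 * P) :=
          mul_le_mul hlogp hp2 hp0.le hlog2P
      _ = 2 * P * Real.log (2 * P) := by ring
  have hmain := jtV_weighted_le_enlarged_mul (D := D) hP2 R S Pr hPr' (fun p => Real.log p / p) hw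
    (by positivity : (0 : ℝ) ≤ 2 * P * Real.log (2 * P)) hW α
  have hV0 := jtV_nonneg' D (2 * D) R S α
  have hV1 := jtV_nonneg' (D * P ^ 2) (8 * (D * P ^ 2)) R S α
  have hM0 : (0 : ℝ) ≤ ((1 + Nat.log P (8 * D) / 2 : ℕ) : ℝ) := Nat.cast_nonneg _
  have hMV : 0 ≤ ((1 + Nat.log P (8 * D) / 2 : ℕ) : ℝ) * jtV (D * P ^ 2) (8 * (D * P ^ 2)) R S α :=
    mul_nonneg hM0 hV1
  have hS0 : 0 ≤ ∑ p ∈ Pr, Real.log p / p *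
      jtV D (2 * D) R S (fun r s => if p ∣ r then α r s else 0) :=
    Finset.sum_nonneg fun p hp => mul_nonneg (hw p hp) (jtV_nonneg' _ _ _ _ _)
  have h14 : (1 : ℝ) / 4 * jtV D (2 * D) R S α ≤ (∑ p ∈ Pr, Real.log p / p) * jtV D (2 * D) R S α :=
    mul_le_mul_of_nonneg_right hquarter hV0
  nlinarith [hmain, h14, hMV, hS0, hlog2P]

end Literature.NumberTheory.Sieve.FriedlanderIwaniecPrimes
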